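import Summits.QuantumFields.YangMills.Theses.ConvexGribovBody
import Literature.MathematicalPhysics.QuantumFieldTheory.LatticeGaugeProofs
import Literature.MathematicalPhysics.QuantumFieldTheory.WilsonWeakCouplingBounds
import Literature.MathematicalPhysics.QuantumFieldTheory.LatticeGaugeDobrushinPoincare
import Literature.MathematicalPhysics.QuantumLattice.TorusWilsonFlowExistence
import Literature.MathematicalPhysics.QuantumLattice.HeatKernelGroupGaugeProofs
import Literature.MathematicalPhysics.QuantumLattice.HeatKernelGroupMeasureProofs

/-!
# Disproof work file — crux `ConvexGribovBody.BrascampLiebVacuum` (stmt-QuantumFields-8779)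

Standing disprover's Lean record (cdisprove, cycle 1, 2026-08-16). Landed on the negative lane
(`Summits/QuantumFields/YangMills/Theorems/BrascampLiebVacuum/Negative/`, all ACCEPTED):
`WilsonTorusToolkit` p102396, `FalseWithoutLocality` p105503, `DmaxVolumeBound` p106875,
`FalseForFiniteGroups` p107556, `FalseWithoutLipschitz` p107836 — import those; the copies below
(namespace `…Cruxes.BrascampLiebVacuum.Disproof`) only make this work file stand-alone. Prose only in docstrings /
comments; every `theorem` without `sorry` is kernel-checked; `sorry` appears ONLY in the
`NearMisses` section, with the obstruction in the docstring.

## Findings (index)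

* **F0 — verdict of cycle 1: NO KILL.** The crux is a weak-coupling, volume-uniform Poincaré
  inequality `Var_μ f ≤ C · Dmax(β,S) · dir f` (`∃ C ∃ β₀ ∀ β ≥ β₀ ∃ S₀ ∀ S ≥ S₀ ∀ admissible f`). To
  refute it one must, for a given `C`, pick `β` and then beat EVERY `S₀(β)`, i.e. exhibit admissible
  `f_S` with `Var/dir > C · Dmax(β,S)` for infinitely many `S` at that `β`. Lower bounds on
  `Var/dir` are cheap (test functions); the missing piece is an `S`-UNIFORM UPPER bound on `Dmax`
  at some fixed large `β` — a quantitative form of the sibling crux `CovarianceBound`, for which no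
  rigorous tool exists (the trivial bound `Dmax ≤ 3N(2S+1)³` is PROVED below, `dmax_le_volume`,
  filed as `Negative/DmaxVolumeBound.lean`, p106875 ACCEPTED — useless against `S₀(β)`: a refuting family
  would need `Var/dir ≫ S³` at fixed `β`, i.e. phase coexistence at weak coupling).
* **F1 — junk hunt negative (statement is robust).** `μ = wilsonMeasure` is a probability measure
  (tree `isProbabilityMeasure_wilsonMeasure`); `Dmax` is genuine (argmin of the slice Coulomb
  functional is non-empty by compactness, `0 ≤ cov ≤ 3N(2S+1)³`, `U ↦ sup_{argmin} cov` is u.s.c.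
  by Berge hence Borel, and Borel = product σ-algebra since `G ↪ U(N)` is second countable);
  under (iii) the metric `slope` is a genuine bounded `limsup` (`≤ K`, filter `𝓝[≠] x ≠ ⊥` on a
  connected non-trivial group) and `U ↦ slope f U e` is a limit of l.s.c. functions, hence Borel;
  `r.N ≥ 1` and `G` non-trivial are forced by "non-abelian"; `G` is CONNECTED
  (`IsSimpleCompactGroup.1`), which blocks the locally-constant `ℤ₂`-character witness
  (`W = ∏_{e∈p} det U_e` for `O(3)`-like groups would have `dir W = 0 < Var W`).
* **F2 — load-bearing hypotheses (theorems below, sorry-free).**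
  (ii) time-zero locality is NECESSARY: `false_without_locality_at` — for every admissible `(G,r)`,
  every `C, β` and `S ≥ 1` the slice-ONE plaquette `Re tr ρ(U_p)` is gauge invariant and
  link-Lipschitz (`4N⁴`) with `dir f = 0 < Var_μ f`; packaged negations `false_without_locality`,
  `not_brascampLiebVacuum_without_locality` (the latter modulo the tree fact
  `isSimpleCompactGroup_specialUnitaryGroup`, only to exhibit one admissible `G = SU(2)`).
  Landed for import as `Summits/QuantumFields/YangMills/Theorems/BrascampLiebVacuum/Negative/`
  `WilsonTorusToolkit.lean` (p102396 ACCEPTED) and `FalseWithoutLocality.lean` (p105503 ACCEPTED);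
  this work file carries verbatim copies under the `…Cruxes.BrascampLiebVacuum.Disproof`
  namespace so that it elaborates stand-alone.
  (iii) Lipschitz is NECESSARY: `brascampLiebVacuum_false_without_lipschitz_at` /
  `_without_lipschitz` / `not_brascampLiebVacuum_without_lipschitz` — for the indicator of
  `{Re tr ρ(U_p) < c}` (`p` the time-ZERO plaquette at the origin; gauge invariant, `t = 0`-local,
  `{0,1}`-valued) EVERY `slope` is `0` (`slope_indicator_eq_zero`: eventually-constant where `f` is
  locally constant in the link, and the JUNK value `sInf ∅ = 0` of an unbounded `limsup` at the
  jump set), so `dir f = 0 < (μA)²·μ{Re tr > c} ≤ Var f`. Filed as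
  `Negative/FalseWithoutLipschitz.lean` (p107836 ACCEPTED; toolkit-only imports, plaquette facts inlined). MORAL: (iii) is the only source
  of an upper bound on the slopes AND of their non-junk meaning; a proof must use it quantitatively.
  (i) gauge invariance is PROBABLY INESSENTIAL (information for provers, not a theorem): the
  single-link marginal of `μ` is exactly Haar (gauge invariance of `μ`), so a non-invariant local
  `f` has `Var/dir = O(1)` (Haar Poincaré on `G`), and gauge-averaging `f ↦ ∫ f(U^g) dg` plus the
  `O(1)` Poincaré constant of the compact gauge ORBIT reduce general `f` to invariant ones at the
  cost `C·Dmax + O(1)`; this is harmless iff `Dmax ≳ const`, expected (`Dmax ≥ avg_p D(p) =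
  3·E‖A_j(0)‖²_F ≍ dim G/β` … but `C·Dmax` vs `O(1)` at large `β` is exactly not uniform: a proof
  for invariant `f` does NOT formally give all `f` with the same β-uniform `C`).
  `IsCompactSimpleLieGroup`: connectedness/non-discreteness is used ESSENTIALLY (for a junk
  reason) — PROVED: `not_brascampLiebVacuum_for_finite_gauge_groups` (UNCONDITIONAL: the crux
  with `IsCompactSimpleLieGroup G` replaced by "`G` finite non-abelian" is false; witness `S₃`,
  discrete topology, permutation representation on `ℂ³`; for a discrete group `𝓝[≠] x = ⊥`,
  every `slope` is `sInf univ = 0`, `dir ≡ 0`, while the time-zero plaquette trace satisfies ALL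
  of (i)–(iii) and has positive variance: `brascampLiebVacuum_false_of_discrete_at`). Filed as
  `Negative/FalseForFiniteGroups.lean` (p107556 ACCEPTED).
* **F3 — the only soft spot: `C` before `β`.** The crux quantifies `∃ C` BEFORE `∀ β ≥ β₀`, while
  the route's `closes` consumes `κ = C·D(β)` per `β` (a `C(β)` would serve `Assembly` unchanged).
  Ideator 1's trap obstruction (`Cruxes/BrascampLiebVacuum/TrapObstruction-ideator1.md`): for
  `SU(N ≥ 5)` fundamental the single-link centre defect is a strict local minimum of the 4d Wilson
  action; an admissible LOCAL `t = 0` test function then has `Var/dir ≥ e^{(2−12π²/N−o(1))β}`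
  (rigorous programme for `N ≥ 60`: DLR lower bound + chessboard upper bound), so the crux FORCES
  `Dmax(β,S) ≥ C⁻¹ e^{(2−12π²/N)β}` for all `S ≥ S₀(β)`; with asymptotic scaling of the Coulomb
  covariance (`Dmax ≍ ξ/β`, `ξ ≍ e^{12π²β/(11N)}`) the β-UNIFORM `C` is physically dead for
  `N ≥ 16` — but NOT refutable: it needs the `S`-uniform upper bound of F0. Recorded precisely as
  `ratio_le_of_inner` (crux + any admissible ratio lower bound ⇒ the same lower bound on
  `C·Dmax`) plus the docstring list of the two missing inputs. RECOMMENDED REPAIR for the planner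
  (costs the route nothing): move `∃ C` after `∀ β ≥ β₀` ("`∃ β₀ ∀ β ≥ β₀ ∃ C > 0 ∃ S₀ …`") —
  typed below as `BrascampLiebVacuumPerBeta` with `brascampLiebVacuumPerBeta_of` (crux ⇒ repair)
  and `closes_of_perBeta` (repair ∧ CovarianceBound ∧ PoincareToGap ∧ ContinuumLegGivenGap ⇒
  YangMills, the route's own `closes` proof with `C` obtained after `β`).
* **F4 — the picked line `Lines/SketchIdeator2.lean` (stubs checked cheaply).**
  `stub_pairIneq`: TRUE numerically with margin ≥ 4 (`min (rhs/lhs) = 4.0` at `L = 1, q = 0`;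
  scan `L ≤ 5000`, `q`-grid `2·10⁴`; `β = (1+q)/2 · (1−q^L)/(1−q)` confirmed) — the constant `3`
  could be lowered. `stub_absSqrt`: Cauchy–Schwarz, true. `stub_momentCone`: TRUE — the two
  Hankel conditions are exactly the truncated STIELTJES conditions for `s₀..s_{2S+1}`; in the
  positive-definite case a representing measure `ν` on `[0,∞)` exists (classical), symmetry
  `s_u = s_{L−u}` folds `ν|_{(1,∞)}` onto `[0,1]` via `x ↦ 1/x` with weight `x^L`, giving the pair
  atoms `(q^u+q^{L−u})/2`; the atom cone is closed (`p_q(0) ≥ 1/2`) and the PSD cone is the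
  closure of its interior, so singular boundary cases follow — no counterexample exists (checked
  by hand at `S = 1, 2`: PSD cone `{a ≥ b ≥ 0}` resp. rank analysis, all representable).
  `stub_rpHankel`: supported by the tree's `wilsonExpectation_oddReflectionPositive` (`L` odd
  `≥ 3`, observables on temporal links `1 ≤ t ≤ S` and spatial links `1 ≤ t ≤ S+1`, includes the
  fixed slice) — fine for `S ≥ 1`, trivial for `S = 0`. `stub_product`, `stub_zeroMode`: physics,
  inherit F3 (their `C_P`, `C_B` are also quantified before `β`); `stub_zeroMode` is implied by the
  crux (`b = L·Var(f̄) ≤ L·Var f`). No stub is cheaply false.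
-/

noncomputable section

open scoped BigOperators Topology Matrix Matrix.Norms.Frobenius
open Filter MeasureTheory
open Literature.MathematicalPhysics.QuantumFieldTheory

namespace Summit.QuantumFields.YangMills.Cruxes.BrascampLiebVacuum.Disproof

/-! ### General lemmas -/

section General

/-- On `ℝ` the `limsup` of the zero function is `0` along EVERY filter (along `⊥` this is the
junk value `sInf univ = 0`). [folklore] -/
theorem limsup_const_zero {α : Type*} (F : Filter α) :
    Filter.limsup (fun _ : α => (0 : ℝ)) F = 0 := by
  rcases F.eq_or_neBot with rfl | hF
  · rw [Filter.limsup_eq]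
    simp only [Filter.eventually_bot, Set.setOf_true]
    exact Real.sInf_of_not_bddBelow not_bddBelow_univ
  · exact Filter.limsup_const 0

variable {d L N : ℕ} {G : Type*} [Group G] [TopologicalSpace G] [IsTopologicalGroup G]
  [CompactSpace G] [MeasurableSpace G] [BorelSpace G]

/-- **The Wilson measure charges every non-empty open set** (continuous `ρ`, any compact `G`,
any `d`, `L`, `β`): it is the open-positive product Haar measure with density
`Z⁻¹ e^{−β S_W} ≥ Z⁻¹ e^{−|β| B} > 0`, `B` a bound for the Wilson action of the finite torus.
Generalises `isOpenPosMeasure_wilsonMeasure_fundamental` (`QCDPhaseQuenchedReweighting.lean`,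
`SU(3)` with its fundamental representation) verbatim. [folklore] -/
theorem isOpenPosMeasure_wilsonMeasure [NeZero L] (ρ : G →* Matrix (Fin N) (Fin N) ℂ)
    (hρ : Continuous ρ) (β : ℝ) :
    (wilsonMeasure (d := d) (L := L) ρ β).IsOpenPosMeasure := by
  obtain ⟨B, hB⟩ := exists_abs_wilsonAction_le (d := d) (L := L) ρ hρ
  haveI := isProbabilityMeasure_wilsonMeasure (d := d) (L := L) ρ hρ β
  haveI : (haarProbability G).IsOpenPosMeasure := by unfold haarProbability; infer_instance
  have hle : ENNReal.ofReal (Real.exp (-(|β| * B))) •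
      (Measure.pi fun _ : Edge d L => haarProbability G) ≤
      wilsonWeight (d := d) (L := L) ρ β := by
    rw [wilsonWeight, ← withDensity_const]
    refine withDensity_mono (Eventually.of_forall fun U => ENNReal.ofReal_le_ofReal
      (Real.exp_le_exp.2 ?_))
    have h1 : β * wilsonAction ρ U ≤ |β| * B :=
      (le_abs_self _).trans (by rw [abs_mul]; exact mul_le_mul_of_nonneg_left (hB U) (abs_nonneg β))
    linarith
  have hZ : (partitionFunction (d := d) (L := L) ρ β)⁻¹ ≠ 0 := by
    intro h0
    have h1 := measure_univ (μ := wilsonMeasure (d := d) (L := L) ρ β)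
    rw [wilsonMeasure, h0, zero_smul] at h1
    simp at h1
  refine ⟨fun O hO hne => ?_⟩
  rw [wilsonMeasure, Measure.smul_apply, smul_eq_mul]
  refine mul_ne_zero hZ (lt_of_lt_of_le ?_ (Measure.le_iff'.1 hle O)).ne'
  rw [Measure.smul_apply, smul_eq_mul]
  exact ENNReal.mul_pos (ENNReal.ofReal_pos.2 (Real.exp_pos _)).ne' (hO.measure_pos _ hne).ne'

omit [Group G] [IsTopologicalGroup G] [CompactSpace G] [MeasurableSpace G] [BorelSpace G] in
/-- **Genuine variance.** Under an open-positive finite measure on a compact space, a continuous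
function taking two different values has `0 < ∫ (f - c)²` for every constant `c`. [folklore] -/
theorem integral_sq_sub_pos {X : Type*} [TopologicalSpace X] [CompactSpace X] [MeasurableSpace X]
    [OpensMeasurableSpace X] (μ : Measure X) [IsFiniteMeasure μ] [μ.IsOpenPosMeasure]
    {f : X → ℝ} (hf : Continuous f) {U₁ U₂ : X} (hne : f U₁ ≠ f U₂) (c : ℝ) :
    0 < ∫ U, (f U - c) ^ 2 ∂μ := by
  have hg : Continuous fun U => (f U - c) ^ 2 := by fun_prop
  have hint : Integrable (fun U => (f U - c) ^ 2) μ :=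
    (BoundedContinuousFunction.mkOfCompact ⟨_, hg⟩).integrable μ
  rw [integral_pos_iff_support_of_nonneg_ae (Eventually.of_forall fun U => sq_nonneg _) hint]
  refine hg.isOpen_support.measure_pos μ ?_
  by_cases h1 : f U₁ = c
  · refine ⟨U₂, ?_⟩
    rw [Function.mem_support]
    have : f U₂ - c ≠ 0 := fun h => hne (by rw [h1]; linarith)
    positivity
  · refine ⟨U₁, ?_⟩
    rw [Function.mem_support]
    have : f U₁ - c ≠ 0 := fun h => h1 (by linarith)
    positivity

end General

/-! ### Matrix and representation lemmas -/

section MatrixLemmas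

variable {N : ℕ}

/-- `√(Σ |M_ab|²)` (the crux's `√fro`) is the Frobenius norm. [folklore] -/
theorem sqrt_sum_sq_eq_norm (M : Matrix (Fin N) (Fin N) ℂ) :
    Real.sqrt (∑ a, ∑ b, ‖M a b‖ ^ 2) = ‖M‖ := by
  rw [← UnitaryCayley.frobenius_norm_sq, Real.sqrt_sq (norm_nonneg _)]

/-- A unitary matrix other than `1` has `Re tr u < N` (`N - Re tr u = ‖1 - u‖² / 2`). [folklore] -/
theorem re_trace_lt_of_ne_one {u : Matrix (Fin N) (Fin N) ℂ}
    (hu : u ∈ Matrix.unitaryGroup (Fin N) ℂ) (h1 : u ≠ 1) : u.trace.re < N := by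
  have h := UnitaryCayley.re_trace_one_sub hu
  rw [Matrix.trace_sub, Complex.sub_re, Matrix.trace_one, Fintype.card_fin] at h
  have hpos : 0 < ‖(1 : Matrix (Fin N) (Fin N) ℂ) - u‖ :=
    norm_pos_iff.2 (sub_ne_zero.2 (Ne.symm h1))
  simp only [Complex.natCast_re] at h
  nlinarith [hpos]

/-- Four-factor telescoping bound in a normed ring. [folklore] -/
theorem norm_mul₄_sub_mul₄_le {A B C D A' B' C' D' : Matrix (Fin N) (Fin N) ℂ} {K : ℝ}
    (hK : 0 ≤ K) (hB : ‖B‖ ≤ K) (hC : ‖C‖ ≤ K) (hD : ‖D‖ ≤ K) (hA' : ‖A'‖ ≤ K)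
    (hB' : ‖B'‖ ≤ K) (hC' : ‖C'‖ ≤ K) :
    ‖A * B * C * D - A' * B' * C' * D'‖ ≤
      K ^ 3 * (‖A - A'‖ + ‖B - B'‖ + ‖C - C'‖ + ‖D - D'‖) := by
  have e : A * B * C * D - A' * B' * C' * D' =
      (A - A') * B * C * D + A' * (B - B') * C * D + A' * B' * (C - C') * D +
        A' * B' * C' * (D - D') := by noncomm_ring
  have n3 : ∀ X Y Z W : Matrix (Fin N) (Fin N) ℂ, ‖X * Y * Z * W‖ ≤ ‖X‖ * ‖Y‖ * ‖Z‖ * ‖W‖ :=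
    fun X Y Z W =>
    calc ‖X * Y * Z * W‖ ≤ ‖X * Y * Z‖ * ‖W‖ := norm_mul_le _ _
      _ ≤ ‖X * Y‖ * ‖Z‖ * ‖W‖ := by gcongr; exact norm_mul_le _ _
      _ ≤ ‖X‖ * ‖Y‖ * ‖Z‖ * ‖W‖ := by gcongr; exact norm_mul_le _ _
  have t1 : ‖(A - A') * B * C * D‖ ≤ ‖A - A'‖ * K * K * K :=
    (n3 _ _ _ _).trans (by gcongr)
  have t2 : ‖A' * (B - B') * C * D‖ ≤ K * ‖B - B'‖ * K * K :=
    (n3 _ _ _ _).trans (by gcongr)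
  have t3 : ‖A' * B' * (C - C') * D‖ ≤ K * K * ‖C - C'‖ * K :=
    (n3 _ _ _ _).trans (by gcongr)
  have t4 : ‖A' * B' * C' * (D - D')‖ ≤ K * K * K * ‖D - D'‖ :=
    (n3 _ _ _ _).trans (by gcongr)
  rw [e]
  calc _ ≤ ‖(A - A') * B * C * D + A' * (B - B') * C * D + A' * B' * (C - C') * D‖ +
        ‖A' * B' * C' * (D - D')‖ := norm_add_le _ _
    _ ≤ ‖(A - A') * B * C * D + A' * (B - B') * C * D‖ + ‖A' * B' * (C - C') * D‖ +
        ‖A' * B' * C' * (D - D')‖ := by gcongr; exact norm_add_le _ _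
    _ ≤ ‖(A - A') * B * C * D‖ + ‖A' * (B - B') * C * D‖ + ‖A' * B' * (C - C') * D‖ +
        ‖A' * B' * C' * (D - D')‖ := by gcongr; exact norm_add_le _ _
    _ ≤ ‖A - A'‖ * K * K * K + K * ‖B - B'‖ * K * K + K * K * ‖C - C'‖ * K +
        K * K * K * ‖D - D'‖ := by gcongr
    _ = K ^ 3 * (‖A - A'‖ + ‖B - B'‖ + ‖C - C'‖ + ‖D - D'‖) := by ring

end MatrixLemmas



/-! ### Plaquette traces as test functions -/

section Plaquette

variable {G : Type*} [Group G] [TopologicalSpace G] [IsTopologicalGroup G] [CompactSpace G]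
  [MeasurableSpace G] [BorelSpace G]

omit [MeasurableSpace G] [BorelSpace G] [IsTopologicalGroup G] [CompactSpace G] in
/-- `U ↦ Re tr ρ(U_p)` is gauge invariant (holonomy conjugates, trace is cyclic). [folklore] -/
theorem isGaugeInvariant_re_trace_plaquette (r : LatticeRep G) {d L : ℕ} (x : Site d L)
    (i j : Fin d) :
    IsGaugeInvariant (fun U : GaugeConfig d L G => (r.ρ (plaquetteHolonomy U x i j)).trace.re) := by
  intro h U
  beta_reduce
  rw [Literature.MathematicalPhysics.QuantumLattice.plaquetteHolonomy_gaugeTransform, map_mul,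
    map_mul, Matrix.trace_mul_cycle, ← map_mul, inv_mul_cancel, map_one, one_mul]

omit [MeasurableSpace G] [BorelSpace G] [CompactSpace G] in
/-- `U ↦ Re tr ρ(U_p)` is continuous. [folklore] -/
theorem continuous_re_trace_plaquette (r : LatticeRep G) {d L : ℕ} (x : Site d L) (i j : Fin d) :
    Continuous (fun U : GaugeConfig d L G => (r.ρ (plaquetteHolonomy U x i j)).trace.re) :=
  Complex.continuous_re.comp (Continuous.matrix_trace (r.continuous.comp
    (Literature.MathematicalPhysics.QuantumLattice.continuous_plaquetteHolonomy x i j)))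

omit [MeasurableSpace G] [BorelSpace G] [IsTopologicalGroup G] [CompactSpace G] in
/-- **Link-Lipschitz property of plaquette traces** in the crux's modulus
`Σₑ √fro(ρ(Uₑ) − ρ(Vₑ))`, with constant `4 N⁴`. [folklore] -/
theorem abs_re_trace_plaquette_sub_le (r : LatticeRep G) {d L : ℕ} [NeZero L] (x : Site d L)
    (i j : Fin d) (U V : GaugeConfig d L G) :
    |(r.ρ (plaquetteHolonomy U x i j)).trace.re - (r.ρ (plaquetteHolonomy V x i j)).trace.re| ≤
      4 * (r.N : ℝ) ^ 4 * ∑ e, Real.sqrt (∑ a, ∑ b, ‖(r.ρ (U e) - r.ρ (V e)) a b‖ ^ 2) := by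
  simp_rw [sqrt_sum_sq_eq_norm]
  unfold plaquetteHolonomy
  simp only [map_mul, map_inv_eq_conjTranspose r.ρ r.mem_unitary]
  rw [← Complex.sub_re, ← Matrix.trace_sub]
  refine (UnitaryCayley.abs_re_trace_le _).trans ?_
  have hN : (0 : ℝ) ≤ r.N := Nat.cast_nonneg _
  have hu : ∀ g, ‖r.ρ g‖ ≤ r.N := fun g =>
    Literature.MathematicalPhysics.QuantumLattice.norm_le_of_mem_unitaryGroup (r.mem_unitary g)
  have huH : ∀ g, ‖(r.ρ g)ᴴ‖ ≤ r.N := fun g => by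
    rw [Matrix.frobenius_norm_conjTranspose]; exact hu g
  have h4 := norm_mul₄_sub_mul₄_le (A := r.ρ (U (x, i))) (A' := r.ρ (V (x, i)))
    (B := r.ρ (U (x.shift i, j))) (B' := r.ρ (V (x.shift i, j)))
    (C := (r.ρ (U (x.shift j, i)))ᴴ) (C' := (r.ρ (V (x.shift j, i)))ᴴ)
    (D := (r.ρ (U (x, j)))ᴴ) (D' := (r.ρ (V (x, j)))ᴴ)
    hN (hu _) (huH _) (huH _) (hu _) (hu _) (huH _)
  rw [← Matrix.conjTranspose_sub, ← Matrix.conjTranspose_sub, Matrix.frobenius_norm_conjTranspose,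
    Matrix.frobenius_norm_conjTranspose] at h4
  have hs : ∀ e₀ : Edge d L,
      ‖r.ρ (U e₀) - r.ρ (V e₀)‖ ≤ ∑ e, ‖r.ρ (U e) - r.ρ (V e)‖ := fun e₀ =>
    Finset.single_le_sum (f := fun e => ‖r.ρ (U e) - r.ρ (V e)‖) (fun _ _ => norm_nonneg _)
      (Finset.mem_univ e₀)
  have hsum := add_le_add (add_le_add (add_le_add (hs (x, i)) (hs (x.shift i, j)))
    (hs (x.shift j, i))) (hs (x, j))
  calc (r.N : ℝ) * ‖_‖ ≤ r.N * ((r.N : ℝ) ^ 3 * (4 * ∑ e, ‖r.ρ (U e) - r.ρ (V e)‖)) := by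
        refine mul_le_mul_of_nonneg_left (h4.trans ?_) hN
        refine mul_le_mul_of_nonneg_left ?_ (by positivity)
        linarith
    _ = 4 * (r.N : ℝ) ^ 4 * ∑ e, ‖r.ρ (U e) - r.ρ (V e)‖ := by ring

omit [MeasurableSpace G] [BorelSpace G] [IsTopologicalGroup G] [CompactSpace G]
  [TopologicalSpace G] in
/-- Exciting the first link of a plaquette of the trivial configuration to `a` gives holonomy `a`,
as soon as `L > 1` and the two directions differ. [folklore] -/
theorem plaquetteHolonomy_update_one {d L : ℕ} [NeZero L] [Fact (1 < L)] (x : Site d L)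
    {i j : Fin d} (hij : i ≠ j) (a : G) :
    plaquetteHolonomy (Function.update (1 : GaugeConfig d L G) (x, i) a) x i j = a := by
  have h2 : ((x.shift i, j) : Edge d L) ≠ (x, i) := by simp [Prod.ext_iff, hij.symm]
  have h3 : ((x.shift j, i) : Edge d L) ≠ (x, i) := by
    intro h
    have := congrArg (fun e : Edge d L => e.1 j) h
    simp [Site.shift] at this
  have h4 : ((x, j) : Edge d L) ≠ (x, i) := by simp [Prod.ext_iff, hij.symm]
  simp [plaquetteHolonomy, Function.update_of_ne h2, Function.update_of_ne h3,
    Function.update_of_ne h4]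

omit [MeasurableSpace G] [BorelSpace G] [IsTopologicalGroup G] [CompactSpace G]
  [TopologicalSpace G] in
/-- A plaquette based in the time slice `t = 1` ignores every time-zero link (`S ≥ 1`, so that
`1 ≠ 0` in `ZMod (2S+1)`; the directions are spatial or not — only the base time matters for
links of direction `≠ 0`, and here both directions are spatial). [folklore] -/
theorem plaquetteHolonomy_update_of_time_zero {S : ℕ} (hS : 1 ≤ S) (U : GaugeConfig 4 (2 * S + 1) G)
    {e : Edge 4 (2 * S + 1)} (he : e.1 0 = 0) (g : G) :
    plaquetteHolonomy (Function.update U e g) (Pi.single 0 1) 1 2 =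
      plaquetteHolonomy U (Pi.single 0 1) 1 2 := by
  haveI : Fact (1 < 2 * S + 1) := ⟨by omega⟩
  have hne : ∀ e' : Edge 4 (2 * S + 1), e'.1 0 = 1 → e' ≠ e := fun e' h' heq => by
    rw [heq, he] at h'
    exact one_ne_zero h'.symm
  have h1 : (((Pi.single 0 1 : Site 4 (2 * S + 1)), (1 : Fin 4)) : Edge 4 (2 * S + 1)) ≠ e :=
    hne _ (by simp)
  have h2 : ((Site.shift (Pi.single 0 1 : Site 4 (2 * S + 1)) 1, (2 : Fin 4)) : Edge 4 (2 * S + 1)) ≠ e :=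
    hne _ (by simp [Site.shift])
  have h3 : ((Site.shift (Pi.single 0 1 : Site 4 (2 * S + 1)) 2, (1 : Fin 4)) : Edge 4 (2 * S + 1)) ≠ e :=
    hne _ (by simp [Site.shift])
  have h4 : (((Pi.single 0 1 : Site 4 (2 * S + 1)), (2 : Fin 4)) : Edge 4 (2 * S + 1)) ≠ e :=
    hne _ (by simp)
  unfold plaquetteHolonomy
  rw [Function.update_of_ne h1, Function.update_of_ne h2, Function.update_of_ne h3,
    Function.update_of_ne h4]

omit [MeasurableSpace G] [BorelSpace G] [IsTopologicalGroup G] in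
/-- A compact simple Lie group in the crux's sense is non-abelian, hence non-trivial. [folklore] -/
theorem exists_ne_one_of_isCompactSimpleLieGroup (hG : IsCompactSimpleLieGroup G) :
    ∃ a : G, a ≠ 1 := by
  have hG' := hG.1
  unfold Literature.MathematicalPhysics.QuantumLattice.IsSimpleCompactGroup at hG'
  obtain ⟨-, ⟨a, b, hab⟩, -⟩ := hG'
  exact ⟨a, fun ha => hab (by rw [ha, one_mul, mul_one])⟩

omit [MeasurableSpace G] [BorelSpace G] [IsTopologicalGroup G] in
/-- In an admissible `(G, r)` some plaquette trace differs from its vacuum value `N`: for `a ≠ 1`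
(which exists, `G` being non-abelian) `Re tr ρ(a) < N = Re tr ρ(1)`. [folklore] -/
theorem exists_re_trace_lt (hG : IsCompactSimpleLieGroup G) (r : LatticeRep G) :
    ∃ a : G, (r.ρ a).trace.re < r.N := by
  obtain ⟨a, ha⟩ := exists_ne_one_of_isCompactSimpleLieGroup hG
  have hρa : r.ρ a ≠ 1 := fun h => ha (r.injective (by rw [h, map_one]))
  exact ⟨a, re_trace_lt_of_ne_one (r.mem_unitary a) hρa⟩

end Plaquette

/-! ### The crux without hypothesis (ii), and its failure -/

section Main

variable {G : Type*} [Group G] [TopologicalSpace G] [IsTopologicalGroup G] [CompactSpace G]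
  [MeasurableSpace G] [BorelSpace G]

/-- **Hypothesis (ii) of the crux is load-bearing, for EVERY admissible `(G, r)`, every `C`, every
coupling `β` and every torus `S ≥ 1`.** The slice-one plaquette `f = Re tr ρ(U_p)`, `p` the
`(1,2)`-plaquette based at `(1,0,0,0)`, is gauge invariant and link-Lipschitz (constant `4N⁴`),
all its time-zero metric slopes vanish identically, so `dir f = 0`, while its variance under
Wilson's measure is positive (the measure charges every open set and `f(1) = N > Re tr ρ(a)` =
`f(1 with one link set to a)` for a suitable `a`). Hence `C · Dmax · dir f = 0 < Var_μ f`. [folklore] -/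
theorem brascampLiebVacuum_false_without_locality_at (hG : IsCompactSimpleLieGroup G)
    (r : LatticeRep G) (C β : ℝ) {S : ℕ} (hS : 1 ≤ S) :
    let μ := wilsonMeasure (d := 4) (L := 2 * S + 1) r.ρ β
    let fro : Matrix (Fin r.N) (Fin r.N) ℂ → ℝ := fun M => ∑ a, ∑ b, ‖M a b‖ ^ 2
    let coul : GaugeConfig 4 (2 * S + 1) G → (Site 4 (2 * S + 1) → G) → ℝ := fun U h =>
      -∑ e : Edge 4 (2 * S + 1),
        (if e.1 0 = 0 ∧ e.2 ≠ 0 then (r.ρ (gaugeTransform h U e)).trace.re else 0)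
    let cov : GaugeConfig 4 (2 * S + 1) G → (Site 4 (2 * S + 1) → G) →
        (Fin 3 → ZMod (2 * S + 1)) → ℝ := fun U h p =>
      (∑ j : Fin 3, fro (∑ y : Fin 3 → ZMod (2 * S + 1),
        Complex.exp (-(2 * Real.pi * Complex.I *
          (∑ i : Fin 3, ((p i).val : ℂ) * ((y i).val : ℂ)) / (2 * S + 1 : ℂ))) •
        ((1 / 2 : ℂ) • (r.ρ (gaugeTransform h U (Fin.cons (0 : ZMod (2 * S + 1)) y, j.succ)) -
          (r.ρ (gaugeTransform h U (Fin.cons (0 : ZMod (2 * S + 1)) y, j.succ)))ᴴ)))) /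
        ((2 * S + 1 : ℝ) ^ 3)
    let Dmax : ℝ := ⨆ p : Fin 3 → ZMod (2 * S + 1),
      ∫ U, (⨆ h : {h : Site 4 (2 * S + 1) → G // ∀ h', coul U h ≤ coul U h'}, cov U h.1 p) ∂μ
    let slope : (GaugeConfig 4 (2 * S + 1) G → ℝ) → GaugeConfig 4 (2 * S + 1) G →
        Edge 4 (2 * S + 1) → ℝ := fun f U e =>
      Filter.limsup (fun g : G => |f (Function.update U e g) - f U| /
        Real.sqrt (fro (r.ρ g - r.ρ (U e)))) (𝓝[≠] (U e))
    let dir : (GaugeConfig 4 (2 * S + 1) G → ℝ) → ℝ := fun f =>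
      ∑ e : Edge 4 (2 * S + 1), (if e.1 0 = 0 ∧ e.2 ≠ 0 then ∫ U, (slope f U e) ^ 2 ∂μ else 0)
    ∃ f : GaugeConfig 4 (2 * S + 1) G → ℝ, IsGaugeInvariant f ∧
      (∃ K : ℝ, ∀ U V : GaugeConfig 4 (2 * S + 1) G,
        |f U - f V| ≤ K * ∑ e, Real.sqrt (fro (r.ρ (U e) - r.ρ (V e)))) ∧
      dir f = 0 ∧ C * Dmax * dir f < ∫ U, (f U - ∫ V, f V ∂μ) ^ 2 ∂μ := by
  intro μ fro coul cov Dmax slope dir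
  refine ⟨(fun U : GaugeConfig 4 (2 * S + 1) G => (r.ρ (plaquetteHolonomy U (Pi.single 0 1) 1 2)).trace.re),
    isGaugeInvariant_re_trace_plaquette r _ 1 2,
    ⟨4 * (r.N : ℝ) ^ 4, fun U V => abs_re_trace_plaquette_sub_le r _ 1 2 U V⟩, ?_⟩
  have hslope : ∀ (U : GaugeConfig 4 (2 * S + 1) G) (e : Edge 4 (2 * S + 1)), e.1 0 = 0 →
      slope (fun U : GaugeConfig 4 (2 * S + 1) G => (r.ρ (plaquetteHolonomy U (Pi.single 0 1) 1 2)).trace.re) U e = 0 := by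
    intro U e he
    show Filter.limsup _ _ = 0
    have : (fun g : G => |(r.ρ (plaquetteHolonomy (Function.update U e g) (Pi.single 0 1) 1 2)).trace.re
          - (r.ρ (plaquetteHolonomy U (Pi.single 0 1) 1 2)).trace.re| /
        Real.sqrt (fro (r.ρ g - r.ρ (U e)))) = fun _ => 0 := by
      funext g
      rw [plaquetteHolonomy_update_of_time_zero hS U he g, sub_self, abs_zero, zero_div]
    rw [this]
    exact limsup_const_zero _
  have hdir : dir (fun U : GaugeConfig 4 (2 * S + 1) G => (r.ρ (plaquetteHolonomy U (Pi.single 0 1) 1 2)).trace.re) = 0 := by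
    show (∑ e : Edge 4 (2 * S + 1), (if e.1 0 = 0 ∧ e.2 ≠ 0 then
      ∫ U, (slope (fun U : GaugeConfig 4 (2 * S + 1) G => (r.ρ (plaquetteHolonomy U (Pi.single 0 1) 1 2)).trace.re) U e) ^ 2 ∂μ else 0)) = 0
    refine Finset.sum_eq_zero fun e _ => ?_
    split_ifs with he
    · simp [hslope _ e he.1]
    · rfl
  refine ⟨hdir, ?_⟩
  rw [hdir, mul_zero]
  haveI : Fact (1 < 2 * S + 1) := ⟨by omega⟩
  haveI : SecondCountableTopology G :=
    (r.continuous.isClosedEmbedding r.injective).isEmbedding.secondCountableTopology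
  haveI := isOpenPosMeasure_wilsonMeasure (d := 4) (L := 2 * S + 1) r.ρ r.continuous β
  haveI := isProbabilityMeasure_wilsonMeasure (d := 4) (L := 2 * S + 1) r.ρ r.continuous β
  obtain ⟨a, ha⟩ := exists_re_trace_lt hG r
  have hne : (fun U : GaugeConfig 4 (2 * S + 1) G => (r.ρ (plaquetteHolonomy U (Pi.single 0 1) 1 2)).trace.re) 1 ≠
      (fun U : GaugeConfig 4 (2 * S + 1) G => (r.ρ (plaquetteHolonomy U (Pi.single 0 1) 1 2)).trace.re)
        (Function.update (1 : GaugeConfig 4 (2 * S + 1) G) ((Pi.single 0 1 : Site 4 (2 * S + 1)), 1) a) := by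
    beta_reduce
    rw [Literature.MathematicalPhysics.QuantumLattice.plaquetteHolonomy_one,
      plaquetteHolonomy_update_one _ (by decide) a, map_one, Matrix.trace_one, Fintype.card_fin,
      Complex.natCast_re]
    exact ha.ne'
  exact integral_sq_sub_pos μ (continuous_re_trace_plaquette r _ 1 2) hne _

/-- **`BrascampLiebVacuum` without (ii) fails at every admissible `(G, r)`**: whatever `C > 0`,
`β₀` and `S₀(β)` are offered, the torus `S = max S₀ 1` at `β = β₀` carries the slice-one plaquette
with `Var_μ f > 0 = C · Dmax · dir f`. Any proof of the crux must therefore USE the restriction to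
functions of the time-zero links; the time-zero Dirichlet form alone does not control
gauge-invariant Lipschitz observables living at other times. [folklore] -/
theorem brascampLiebVacuum_false_without_locality (hG : IsCompactSimpleLieGroup G)
    (r : LatticeRep G) :
    ¬ (∃ C : ℝ, 0 < C ∧ ∃ β₀ : ℝ, ∀ β : ℝ, β₀ ≤ β → ∃ S₀ : ℕ, ∀ S : ℕ, S₀ ≤ S →
    let μ := wilsonMeasure (d := 4) (L := 2 * S + 1) r.ρ β
    let fro : Matrix (Fin r.N) (Fin r.N) ℂ → ℝ := fun M => ∑ a, ∑ b, ‖M a b‖ ^ 2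
    let coul : GaugeConfig 4 (2 * S + 1) G → (Site 4 (2 * S + 1) → G) → ℝ := fun U h =>
      -∑ e : Edge 4 (2 * S + 1),
        (if e.1 0 = 0 ∧ e.2 ≠ 0 then (r.ρ (gaugeTransform h U e)).trace.re else 0)
    let cov : GaugeConfig 4 (2 * S + 1) G → (Site 4 (2 * S + 1) → G) →
        (Fin 3 → ZMod (2 * S + 1)) → ℝ := fun U h p =>
      (∑ j : Fin 3, fro (∑ y : Fin 3 → ZMod (2 * S + 1),
        Complex.exp (-(2 * Real.pi * Complex.I *
          (∑ i : Fin 3, ((p i).val : ℂ) * ((y i).val : ℂ)) / (2 * S + 1 : ℂ))) •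
        ((1 / 2 : ℂ) • (r.ρ (gaugeTransform h U (Fin.cons (0 : ZMod (2 * S + 1)) y, j.succ)) -
          (r.ρ (gaugeTransform h U (Fin.cons (0 : ZMod (2 * S + 1)) y, j.succ)))ᴴ)))) /
        ((2 * S + 1 : ℝ) ^ 3)
    let Dmax : ℝ := ⨆ p : Fin 3 → ZMod (2 * S + 1),
      ∫ U, (⨆ h : {h : Site 4 (2 * S + 1) → G // ∀ h', coul U h ≤ coul U h'}, cov U h.1 p) ∂μ
    let slope : (GaugeConfig 4 (2 * S + 1) G → ℝ) → GaugeConfig 4 (2 * S + 1) G →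
        Edge 4 (2 * S + 1) → ℝ := fun f U e =>
      Filter.limsup (fun g : G => |f (Function.update U e g) - f U| /
        Real.sqrt (fro (r.ρ g - r.ρ (U e)))) (𝓝[≠] (U e))
    let dir : (GaugeConfig 4 (2 * S + 1) G → ℝ) → ℝ := fun f =>
      ∑ e : Edge 4 (2 * S + 1), (if e.1 0 = 0 ∧ e.2 ≠ 0 then ∫ U, (slope f U e) ^ 2 ∂μ else 0)
    ∀ f : GaugeConfig 4 (2 * S + 1) G → ℝ, IsGaugeInvariant f →
      (∃ K : ℝ, ∀ U V : GaugeConfig 4 (2 * S + 1) G,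
        |f U - f V| ≤ K * ∑ e, Real.sqrt (fro (r.ρ (U e) - r.ρ (V e)))) →
      ∫ U, (f U - ∫ V, f V ∂μ) ^ 2 ∂μ ≤ C * Dmax * dir f) := by
  rintro ⟨C, -, β₀, h⟩
  obtain ⟨S₀, hS₀⟩ := h β₀ le_rfl
  have h1 := hS₀ (max S₀ 1) (le_max_left _ _)
  obtain ⟨f, hf₁, hf₃, -, hlt⟩ := brascampLiebVacuum_false_without_locality_at hG r C β₀
    (S := max S₀ 1) (le_max_right _ _)
  exact absurd (h1 f hf₁ hf₃) (not_le.2 hlt)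

/-- **The crux with hypothesis (ii) deleted is false** — `ConvexGribovBody.BrascampLiebVacuum`
with the time-zero locality clause `(∀ U V, (∀ e, e.1 0 = 0 → e.2 ≠ 0 → U e = V e) → f U = f V)`
removed and everything else verbatim (same `μ`, `fro`, `coul`, `cov`, `Dmax`, `slope`, `dir`),
i.e. the natural strengthening "Poincaré for ALL gauge-invariant link-Lipschitz `f` with the
time-zero spatial Dirichlet form" — modulo the tree's named fact
`isSimpleCompactGroup_specialUnitaryGroup` (simplicity of `SU(n)`), needed only to exhibit ONE
group admitted by the hypothesis `IsCompactSimpleLieGroup` (here `SU(2)`, fundamental `r`); the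
failure itself is unconditional at every admissible `(G, r)`
(`brascampLiebVacuum_false_without_locality`). [folklore] -/
theorem not_brascampLiebVacuum_without_locality
    (h : Literature.MathematicalPhysics.QuantumLattice.isSimpleCompactGroup_specialUnitaryGroup.{0}) :
    ¬ (∀ (G : Type) [Group G] [TopologicalSpace G] [IsTopologicalGroup G] [CompactSpace G]
      [MeasurableSpace G] [BorelSpace G], IsCompactSimpleLieGroup G → ∀ r : LatticeRep G,
      ∃ C : ℝ, 0 < C ∧ ∃ β₀ : ℝ, ∀ β : ℝ, β₀ ≤ β → ∃ S₀ : ℕ, ∀ S : ℕ, S₀ ≤ S →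
      let μ := wilsonMeasure (d := 4) (L := 2 * S + 1) r.ρ β
      let fro : Matrix (Fin r.N) (Fin r.N) ℂ → ℝ := fun M => ∑ a, ∑ b, ‖M a b‖ ^ 2
      let coul : GaugeConfig 4 (2 * S + 1) G → (Site 4 (2 * S + 1) → G) → ℝ := fun U h =>
        -∑ e : Edge 4 (2 * S + 1),
          (if e.1 0 = 0 ∧ e.2 ≠ 0 then (r.ρ (gaugeTransform h U e)).trace.re else 0)
      let cov : GaugeConfig 4 (2 * S + 1) G → (Site 4 (2 * S + 1) → G) →
          (Fin 3 → ZMod (2 * S + 1)) → ℝ := fun U h p =>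
        (∑ j : Fin 3, fro (∑ y : Fin 3 → ZMod (2 * S + 1),
          Complex.exp (-(2 * Real.pi * Complex.I *
            (∑ i : Fin 3, ((p i).val : ℂ) * ((y i).val : ℂ)) / (2 * S + 1 : ℂ))) •
          ((1 / 2 : ℂ) • (r.ρ (gaugeTransform h U (Fin.cons (0 : ZMod (2 * S + 1)) y, j.succ)) -
            (r.ρ (gaugeTransform h U (Fin.cons (0 : ZMod (2 * S + 1)) y, j.succ)))ᴴ)))) /
          ((2 * S + 1 : ℝ) ^ 3)
      let Dmax : ℝ := ⨆ p : Fin 3 → ZMod (2 * S + 1),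
        ∫ U, (⨆ h : {h : Site 4 (2 * S + 1) → G // ∀ h', coul U h ≤ coul U h'}, cov U h.1 p) ∂μ
      let slope : (GaugeConfig 4 (2 * S + 1) G → ℝ) → GaugeConfig 4 (2 * S + 1) G →
          Edge 4 (2 * S + 1) → ℝ := fun f U e =>
        Filter.limsup (fun g : G => |f (Function.update U e g) - f U| /
          Real.sqrt (fro (r.ρ g - r.ρ (U e)))) (𝓝[≠] (U e))
      let dir : (GaugeConfig 4 (2 * S + 1) G → ℝ) → ℝ := fun f =>
        ∑ e : Edge 4 (2 * S + 1), (if e.1 0 = 0 ∧ e.2 ≠ 0 then ∫ U, (slope f U e) ^ 2 ∂μ else 0)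
      ∀ f : GaugeConfig 4 (2 * S + 1) G → ℝ, IsGaugeInvariant f →
        (∃ K : ℝ, ∀ U V : GaugeConfig 4 (2 * S + 1) G,
          |f U - f V| ≤ K * ∑ e, Real.sqrt (fro (r.ρ (U e) - r.ρ (V e)))) →
        ∫ U, (f U - ∫ V, f V ∂μ) ^ 2 ∂μ ≤ C * Dmax * dir f) := by
  intro hBL
  have hSU := isCompactSimpleLieGroup_specialUnitaryGroup h (le_refl 2)
  obtain ⟨r⟩ := hSU.2
  exact brascampLiebVacuum_false_without_locality hSU r (hBL _ hSU r)

end Main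



section Lipschitz

variable {G : Type*} [Group G] [TopologicalSpace G] [IsTopologicalGroup G] [CompactSpace G]
  [MeasurableSpace G] [BorelSpace G]

omit [MeasurableSpace G] [BorelSpace G] [IsTopologicalGroup G] [CompactSpace G]
  [TopologicalSpace G] in
/-- The `(1,2)`-plaquette at the origin is a function of time-zero spatial links only. [folklore] -/
theorem plaquetteHolonomy_origin_eq_of_agree {S : ℕ} (U V : GaugeConfig 4 (2 * S + 1) G)
    (h : ∀ e : Edge 4 (2 * S + 1), e.1 0 = 0 → e.2 ≠ 0 → U e = V e) :
    plaquetteHolonomy U 0 1 2 = plaquetteHolonomy V 0 1 2 := by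
  unfold plaquetteHolonomy
  have h10 : (1 : Fin 4) ≠ 0 := by decide
  have h20 : (2 : Fin 4) ≠ 0 := by decide
  rw [h (0, 1) rfl h10, h (Site.shift 0 1, 2) (by simp [Site.shift]) h20,
    h (Site.shift 0 2, 1) (by simp [Site.shift]) h10, h (0, 2) rfl h20]

omit [MeasurableSpace G] [BorelSpace G] [IsTopologicalGroup G] [CompactSpace G] in
/-- **Every metric slope of a `{0,1}`-valued function vanishes in Lean's conventions.** Along any
link, either the function is eventually constant (quotient eventually `0`) or the quotient
`1 / ‖ρ g − ρ(U e)‖_F` is unbounded near `U e`, the defining set of the `limsup` is empty and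
`sInf ∅ = 0`. (`ρ` injective and continuous; no measure theory involved.) [folklore] -/
theorem slope_indicator_eq_zero (r : LatticeRep G) {d L : ℕ} (A : Set (GaugeConfig d L G))
    (U : GaugeConfig d L G) (e : Edge d L) :
    Filter.limsup (fun g : G => |A.indicator (fun _ => (1 : ℝ)) (Function.update U e g) -
        A.indicator (fun _ => (1 : ℝ)) U| /
      Real.sqrt (∑ a, ∑ b, ‖(r.ρ g - r.ρ (U e)) a b‖ ^ 2)) (𝓝[≠] (U e)) = 0 := by
  simp_rw [sqrt_sum_sq_eq_norm]
  set q := fun g : G => |A.indicator (fun _ => (1 : ℝ)) (Function.update U e g) -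
      A.indicator (fun _ => (1 : ℝ)) U| / ‖r.ρ g - r.ρ (U e)‖ with hq
  by_cases hev : ∀ᶠ g in 𝓝[≠] (U e),
      A.indicator (fun _ => (1 : ℝ)) (Function.update U e g) = A.indicator (fun _ => (1 : ℝ)) U
  · have : q =ᶠ[𝓝[≠] (U e)] fun _ => 0 :=
      hev.mono fun g hg => by simp only [hq, hg, sub_self, abs_zero, zero_div]
    rw [Filter.limsup_congr this]
    exact limsup_const_zero _
  · rw [Filter.limsup_eq]
    suffices hempty : {a : ℝ | ∀ᶠ n in 𝓝[≠] (U e), q n ≤ a} = ∅ by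
      rw [hempty]; exact Real.sInf_empty
    refine Set.eq_empty_iff_forall_notMem.2 fun b hb => ?_
    rw [Set.mem_setOf_eq] at hb
    have hfr : ∃ᶠ g in 𝓝[≠] (U e), A.indicator (fun _ => (1 : ℝ)) (Function.update U e g) ≠
        A.indicator (fun _ => (1 : ℝ)) U := Filter.not_eventually.1 hev
    have hcont : Continuous fun g : G => ‖r.ρ g - r.ρ (U e)‖ :=
      (r.continuous.sub continuous_const).norm
    have h0 : ‖r.ρ (U e) - r.ρ (U e)‖ < 1 / (|b| + 1) := by
      rw [sub_self, norm_zero]; positivity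
    have hsmall : ∀ᶠ g in 𝓝[≠] (U e), ‖r.ρ g - r.ρ (U e)‖ < 1 / (|b| + 1) :=
      nhdsWithin_le_nhds ((hcont.tendsto (U e)).eventually (gt_mem_nhds h0))
    have hpos : ∀ᶠ g in 𝓝[≠] (U e), 0 < ‖r.ρ g - r.ρ (U e)‖ := by
      refine eventually_nhdsWithin_of_forall fun g hg => norm_pos_iff.2 (sub_ne_zero.2 ?_)
      exact fun h => hg (r.injective h)
    have hev3 : ∀ᶠ g in 𝓝[≠] (U e), q g ≤ b ∧ ‖r.ρ g - r.ρ (U e)‖ < 1 / (|b| + 1) ∧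
        0 < ‖r.ρ g - r.ρ (U e)‖ := hb.and (hsmall.and hpos)
    obtain ⟨g, hne, hqb, hgs, hgp⟩ := (hfr.and_eventually hev3).exists
    have habs : |A.indicator (fun _ => (1 : ℝ)) (Function.update U e g) -
        A.indicator (fun _ => (1 : ℝ)) U| = 1 := by
      by_cases h1 : Function.update U e g ∈ A <;> by_cases h2 : U ∈ A <;>
        simp [Set.indicator_of_mem, Set.indicator_of_notMem, h1, h2] at hne ⊢
    have hqg : q g = 1 / ‖r.ρ g - r.ρ (U e)‖ := by simp only [hq, habs]
    have h1 : |b| + 1 < 1 / ‖r.ρ g - r.ρ (U e)‖ := by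
      have := one_div_lt_one_div_of_lt hgp hgs
      rwa [one_div_one_div] at this
    have h2 : q g ≤ b := hqb
    rw [hqg] at h2
    linarith [le_abs_self b]

/-- **Hypothesis (iii) of the crux is load-bearing, for EVERY admissible `(G, r)`, every `C`,
every coupling `β` and every torus `S ≥ 1`**: the indicator of `{Re tr ρ(U_p) < c}` (`p` the
time-zero plaquette at the origin, `c` between `Re tr ρ(a)` and `N`) is gauge invariant and a
function of the time-zero spatial links, has `dir f = 0` (all slopes vanish,
`slope_indicator_eq_zero`) and positive variance. Hence `C · Dmax · dir f = 0 < Var_μ f`. [folklore] -/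
theorem brascampLiebVacuum_false_without_lipschitz_at (hG : IsCompactSimpleLieGroup G) {S : ℕ}
    (hS : 1 ≤ S) (r : LatticeRep G) (C β : ℝ) :
    let μ := wilsonMeasure (d := 4) (L := 2 * S + 1) r.ρ β
    let fro : Matrix (Fin r.N) (Fin r.N) ℂ → ℝ := fun M => ∑ a, ∑ b, ‖M a b‖ ^ 2
    let coul : GaugeConfig 4 (2 * S + 1) G → (Site 4 (2 * S + 1) → G) → ℝ := fun U h =>
      -∑ e : Edge 4 (2 * S + 1),
        (if e.1 0 = 0 ∧ e.2 ≠ 0 then (r.ρ (gaugeTransform h U e)).trace.re else 0)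
    let cov : GaugeConfig 4 (2 * S + 1) G → (Site 4 (2 * S + 1) → G) →
        (Fin 3 → ZMod (2 * S + 1)) → ℝ := fun U h p =>
      (∑ j : Fin 3, fro (∑ y : Fin 3 → ZMod (2 * S + 1),
        Complex.exp (-(2 * Real.pi * Complex.I *
          (∑ i : Fin 3, ((p i).val : ℂ) * ((y i).val : ℂ)) / (2 * S + 1 : ℂ))) •
        ((1 / 2 : ℂ) • (r.ρ (gaugeTransform h U (Fin.cons (0 : ZMod (2 * S + 1)) y, j.succ)) -
          (r.ρ (gaugeTransform h U (Fin.cons (0 : ZMod (2 * S + 1)) y, j.succ)))ᴴ)))) /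
        ((2 * S + 1 : ℝ) ^ 3)
    let Dmax : ℝ := ⨆ p : Fin 3 → ZMod (2 * S + 1),
      ∫ U, (⨆ h : {h : Site 4 (2 * S + 1) → G // ∀ h', coul U h ≤ coul U h'}, cov U h.1 p) ∂μ
    let slope : (GaugeConfig 4 (2 * S + 1) G → ℝ) → GaugeConfig 4 (2 * S + 1) G →
        Edge 4 (2 * S + 1) → ℝ := fun f U e =>
      Filter.limsup (fun g : G => |f (Function.update U e g) - f U| /
        Real.sqrt (fro (r.ρ g - r.ρ (U e)))) (𝓝[≠] (U e))
    let dir : (GaugeConfig 4 (2 * S + 1) G → ℝ) → ℝ := fun f =>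
      ∑ e : Edge 4 (2 * S + 1), (if e.1 0 = 0 ∧ e.2 ≠ 0 then ∫ U, (slope f U e) ^ 2 ∂μ else 0)
    ∃ f : GaugeConfig 4 (2 * S + 1) G → ℝ, IsGaugeInvariant f ∧
      (∀ U V : GaugeConfig 4 (2 * S + 1) G,
        (∀ e : Edge 4 (2 * S + 1), e.1 0 = 0 → e.2 ≠ 0 → U e = V e) → f U = f V) ∧
      (∀ U, f U = 0 ∨ f U = 1) ∧
      dir f = 0 ∧ C * Dmax * dir f < ∫ U, (f U - ∫ V, f V ∂μ) ^ 2 ∂μ := by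
  intro μ fro coul cov Dmax slope dir
  haveI : Fact (1 < 2 * S + 1) := ⟨by omega⟩
  -- some `a` with `Re tr ρ(a) < N` (`G` non-abelian, `ρ` faithful unitary)
  obtain ⟨a, ha⟩ : ∃ a : G, (r.ρ a).trace.re < r.N := by
    have hG' := hG.1
    unfold Literature.MathematicalPhysics.QuantumLattice.IsSimpleCompactGroup at hG'
    obtain ⟨-, ⟨a, b, hab⟩, -⟩ := hG'
    have ha1 : a ≠ 1 := fun ha => hab (by rw [ha, one_mul, mul_one])
    have hρa : r.ρ a ≠ 1 := fun h => ha1 (r.injective (by rw [h, map_one]))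
    exact ⟨a, re_trace_lt_of_ne_one (r.mem_unitary a) hρa⟩
  -- the time-zero plaquette trace at the origin: invariance, locality, values (inlined)
  have hGI : IsGaugeInvariant (fun U : GaugeConfig 4 (2 * S + 1) G => (r.ρ (plaquetteHolonomy U 0 1 2)).trace.re) := fun h U => by
    beta_reduce
    rw [Literature.MathematicalPhysics.QuantumLattice.plaquetteHolonomy_gaugeTransform, map_mul,
      map_mul, Matrix.trace_mul_cycle, ← map_mul, inv_mul_cancel, map_one, one_mul]
  have h10 : (1 : Fin 4) ≠ 0 := by decide
  have h20 : (2 : Fin 4) ≠ 0 := by decide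
  have hloc : ∀ U V : GaugeConfig 4 (2 * S + 1) G,
      (∀ e : Edge 4 (2 * S + 1), e.1 0 = 0 → e.2 ≠ 0 → U e = V e) →
      plaquetteHolonomy U 0 1 2 = plaquetteHolonomy V 0 1 2 := fun U V h => by
    unfold plaquetteHolonomy
    rw [h (0, 1) rfl h10, h (Site.shift 0 1, 2) (by simp [Site.shift]) h20,
      h (Site.shift 0 2, 1) (by simp [Site.shift]) h10, h (0, 2) rfl h20]
  have hupd : ∀ a : G, plaquetteHolonomy
      (Function.update (1 : GaugeConfig 4 (2 * S + 1) G) ((0 : Site 4 (2 * S + 1)), 1) a) 0 1 2 = a := by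
    intro a
    have h3 : ((Site.shift (0 : Site 4 (2 * S + 1)) 2, (1 : Fin 4)) : Edge 4 (2 * S + 1)) ≠ (0, 1) := by
      intro h
      have := congrArg (fun e : Edge 4 (2 * S + 1) => e.1 2) h
      simp [Site.shift] at this
    simp [plaquetteHolonomy, Function.update_of_ne h3]
  have hcont : Continuous (fun U : GaugeConfig 4 (2 * S + 1) G => (r.ρ (plaquetteHolonomy U 0 1 2)).trace.re) :=
    Complex.continuous_re.comp (Continuous.matrix_trace (r.continuous.comp
      (Literature.MathematicalPhysics.QuantumLattice.continuous_plaquetteHolonomy 0 1 2)))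
  set c : ℝ := ((r.ρ a).trace.re + r.N) / 2 with hc
  set g₀ : GaugeConfig 4 (2 * S + 1) G → ℝ :=
    fun U => (r.ρ (plaquetteHolonomy U 0 1 2)).trace.re with hg₀
  set A : Set (GaugeConfig 4 (2 * S + 1) G) := {U | g₀ U < c} with hA
  refine ⟨A.indicator (fun _ => (1 : ℝ)), ?_, ?_, ?_, ?_⟩
  · intro h U
    have hinv := hGI h U
    beta_reduce at hinv
    have hmem : gaugeTransform h U ∈ A ↔ U ∈ A := by
      simp only [hA, Set.mem_setOf_eq]
      rw [hinv]
    by_cases hU : U ∈ A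
    · rw [Set.indicator_of_mem hU, Set.indicator_of_mem (hmem.2 hU)]
    · rw [Set.indicator_of_notMem hU, Set.indicator_of_notMem (mt hmem.1 hU)]
  · intro U V hUV
    have hmem : U ∈ A ↔ V ∈ A := by
      simp only [hA, Set.mem_setOf_eq, hg₀]
      rw [hloc U V hUV]
    by_cases hU : U ∈ A
    · rw [Set.indicator_of_mem hU, Set.indicator_of_mem (hmem.1 hU)]
    · rw [Set.indicator_of_notMem hU, Set.indicator_of_notMem (mt hmem.2 hU)]
  · intro U
    by_cases hU : U ∈ A
    · exact Or.inr (Set.indicator_of_mem hU _)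
    · exact Or.inl (Set.indicator_of_notMem hU _)
  have hdir : dir (A.indicator fun _ => (1 : ℝ)) = 0 := by
    show (∑ e : Edge 4 (2 * S + 1), (if e.1 0 = 0 ∧ e.2 ≠ 0 then
      ∫ U, (slope (A.indicator fun _ => (1 : ℝ)) U e) ^ 2 ∂μ else 0)) = 0
    refine Finset.sum_eq_zero fun e _ => ?_
    split_ifs with he
    · have : ∀ U, slope (A.indicator fun _ => (1 : ℝ)) U e = 0 := fun U =>
        slope_indicator_eq_zero r A U e
      simp [this]
    · rfl
  refine ⟨hdir, ?_⟩
  rw [hdir, mul_zero]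
  -- positivity of the variance
  haveI : SecondCountableTopology G :=
    (r.continuous.isClosedEmbedding r.injective).isEmbedding.secondCountableTopology
  haveI := isOpenPosMeasure_wilsonMeasure (d := 4) (L := 2 * S + 1) r.ρ r.continuous β
  haveI := isProbabilityMeasure_wilsonMeasure (d := 4) (L := 2 * S + 1) r.ρ r.continuous β
  have hg₀c : Continuous g₀ := hcont
  have hAo : IsOpen A := isOpen_lt hg₀c continuous_const
  set B : Set (GaugeConfig 4 (2 * S + 1) G) := {U | c < g₀ U} with hB
  have hBo : IsOpen B := isOpen_lt continuous_const hg₀c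
  have hcN : c < r.N := by rw [hc]; linarith
  have hca : (r.ρ a).trace.re < c := by rw [hc]; linarith
  have hBne : B.Nonempty := ⟨1, by
    simp only [hB, Set.mem_setOf_eq, hg₀, Literature.MathematicalPhysics.QuantumLattice.plaquetteHolonomy_one,
      map_one, Matrix.trace_one, Fintype.card_fin, Complex.natCast_re]
    exact hcN⟩
  have hAne : A.Nonempty := ⟨Function.update (1 : GaugeConfig 4 (2 * S + 1) G) ((0 : Site 4 (2 * S + 1)), 1) a, by
    simp only [hA, Set.mem_setOf_eq, hg₀]
    rw [hupd a]
    exact hca⟩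
  have hAm : MeasurableSet A := hAo.measurableSet
  have hBm : MeasurableSet B := hBo.measurableSet
  set m : ℝ := ∫ V, A.indicator (fun _ => (1 : ℝ)) V ∂μ with hm
  have hmA : m = μ.real A := by
    rw [hm, integral_indicator_const _ hAm, smul_eq_mul, mul_one]
  have hmpos : 0 < m := by
    rw [hmA, measureReal_def]
    exact ENNReal.toReal_pos (hAo.measure_pos μ hAne).ne' (measure_ne_top μ A)
  have hBpos : 0 < μ.real B := by
    rw [measureReal_def]
    exact ENNReal.toReal_pos (hBo.measure_pos μ hBne).ne' (measure_ne_top μ B)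
  -- pointwise lower bound `m² · 1_B ≤ (f - m)²` (on `B`, `f = 0`)
  have hAB : ∀ U ∈ B, U ∉ A := fun U hUB hUA => by
    simp only [hA, hB, Set.mem_setOf_eq] at hUA hUB
    linarith
  have hpt : ∀ U, B.indicator (fun _ => m ^ 2) U ≤
      (A.indicator (fun _ => (1 : ℝ)) U - m) ^ 2 := fun U => by
    by_cases hUB : U ∈ B
    · rw [Set.indicator_of_mem hUB, Set.indicator_of_notMem (hAB U hUB)]
      ring_nf
      exact le_rfl
    · rw [Set.indicator_of_notMem hUB]
      exact sq_nonneg _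
  have hint1 : Integrable (B.indicator fun _ => m ^ 2) μ := (integrable_const _).indicator hBm
  have hfint : Integrable (A.indicator fun _ => (1 : ℝ)) μ := (integrable_const _).indicator hAm
  have hint2 : Integrable (fun U => (A.indicator (fun _ => (1 : ℝ)) U - m) ^ 2) μ := by
    refine Integrable.mono' (integrable_const ((1 + |m|) ^ 2))
      ((hfint.sub (integrable_const m)).aestronglyMeasurable.pow 2) (Eventually.of_forall fun U => ?_)
    rw [Real.norm_eq_abs, abs_pow]
    have h1 : |A.indicator (fun _ => (1 : ℝ)) U| ≤ 1 := by
      by_cases hU : U ∈ A <;> simp [Set.indicator_of_mem, Set.indicator_of_notMem, hU]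
    have h2 : |A.indicator (fun _ => (1 : ℝ)) U - m| ≤ 1 + |m| :=
      (abs_sub _ _).trans (by linarith)
    exact pow_le_pow_left₀ (abs_nonneg _) h2 2
  calc (0 : ℝ) < μ.real B * m ^ 2 := by positivity
    _ = ∫ U, B.indicator (fun _ => m ^ 2) U ∂μ := by
        rw [integral_indicator_const _ hBm, smul_eq_mul]
    _ ≤ ∫ U, (A.indicator (fun _ => (1 : ℝ)) U - m) ^ 2 ∂μ := integral_mono hint1 hint2 hpt

/-- **`BrascampLiebVacuum` without (iii) fails at every admissible `(G, r)`** (any `C > 0`, `β₀`,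
`S₀(β)`: take `β = β₀`, `S = max S₀ 1` and the indicator witness). [folklore] -/
theorem brascampLiebVacuum_false_without_lipschitz (hG : IsCompactSimpleLieGroup G)
    (r : LatticeRep G) :
    ¬ (∃ C : ℝ, 0 < C ∧ ∃ β₀ : ℝ, ∀ β : ℝ, β₀ ≤ β → ∃ S₀ : ℕ, ∀ S : ℕ, S₀ ≤ S →
    let μ := wilsonMeasure (d := 4) (L := 2 * S + 1) r.ρ β
    let fro : Matrix (Fin r.N) (Fin r.N) ℂ → ℝ := fun M => ∑ a, ∑ b, ‖M a b‖ ^ 2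
    let coul : GaugeConfig 4 (2 * S + 1) G → (Site 4 (2 * S + 1) → G) → ℝ := fun U h =>
      -∑ e : Edge 4 (2 * S + 1),
        (if e.1 0 = 0 ∧ e.2 ≠ 0 then (r.ρ (gaugeTransform h U e)).trace.re else 0)
    let cov : GaugeConfig 4 (2 * S + 1) G → (Site 4 (2 * S + 1) → G) →
        (Fin 3 → ZMod (2 * S + 1)) → ℝ := fun U h p =>
      (∑ j : Fin 3, fro (∑ y : Fin 3 → ZMod (2 * S + 1),
        Complex.exp (-(2 * Real.pi * Complex.I *
          (∑ i : Fin 3, ((p i).val : ℂ) * ((y i).val : ℂ)) / (2 * S + 1 : ℂ))) •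
        ((1 / 2 : ℂ) • (r.ρ (gaugeTransform h U (Fin.cons (0 : ZMod (2 * S + 1)) y, j.succ)) -
          (r.ρ (gaugeTransform h U (Fin.cons (0 : ZMod (2 * S + 1)) y, j.succ)))ᴴ)))) /
        ((2 * S + 1 : ℝ) ^ 3)
    let Dmax : ℝ := ⨆ p : Fin 3 → ZMod (2 * S + 1),
      ∫ U, (⨆ h : {h : Site 4 (2 * S + 1) → G // ∀ h', coul U h ≤ coul U h'}, cov U h.1 p) ∂μ
    let slope : (GaugeConfig 4 (2 * S + 1) G → ℝ) → GaugeConfig 4 (2 * S + 1) G →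
        Edge 4 (2 * S + 1) → ℝ := fun f U e =>
      Filter.limsup (fun g : G => |f (Function.update U e g) - f U| /
        Real.sqrt (fro (r.ρ g - r.ρ (U e)))) (𝓝[≠] (U e))
    let dir : (GaugeConfig 4 (2 * S + 1) G → ℝ) → ℝ := fun f =>
      ∑ e : Edge 4 (2 * S + 1), (if e.1 0 = 0 ∧ e.2 ≠ 0 then ∫ U, (slope f U e) ^ 2 ∂μ else 0)
    ∀ f : GaugeConfig 4 (2 * S + 1) G → ℝ, IsGaugeInvariant f →
      (∀ U V : GaugeConfig 4 (2 * S + 1) G,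
        (∀ e : Edge 4 (2 * S + 1), e.1 0 = 0 → e.2 ≠ 0 → U e = V e) → f U = f V) →
      ∫ U, (f U - ∫ V, f V ∂μ) ^ 2 ∂μ ≤ C * Dmax * dir f) := by
  rintro ⟨C, -, β₀, h⟩
  obtain ⟨S₀, hS₀⟩ := h β₀ le_rfl
  have h1 := hS₀ (max S₀ 1) (le_max_left _ _)
  obtain ⟨f, hf₁, hf₂, -, -, hlt⟩ := brascampLiebVacuum_false_without_lipschitz_at hG
    (S := max S₀ 1) (le_max_right _ _) r C β₀
  exact absurd (h1 f hf₁ hf₂) (not_le.2 hlt)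

/-- **The crux with hypothesis (iii) deleted is false** — `ConvexGribovBody.BrascampLiebVacuum`
with the Lipschitz clause `(∃ K, ∀ U V, |f U - f V| ≤ K * Σₑ √fro(ρ(U e) − ρ(V e)))` removed and
everything else verbatim; modulo the tree's named fact `isSimpleCompactGroup_specialUnitaryGroup`,
used only to exhibit one admissible group (`SU(2)`, fundamental `r`); the failure itself is
unconditional at every admissible `(G, r)` (`brascampLiebVacuum_false_without_lipschitz`). [folklore] -/
theorem not_brascampLiebVacuum_without_lipschitz
    (h : Literature.MathematicalPhysics.QuantumLattice.isSimpleCompactGroup_specialUnitaryGroup.{0}) :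
    ¬ (∀ (G : Type) [Group G] [TopologicalSpace G] [IsTopologicalGroup G] [CompactSpace G]
      [MeasurableSpace G] [BorelSpace G], IsCompactSimpleLieGroup G → ∀ r : LatticeRep G,
      ∃ C : ℝ, 0 < C ∧ ∃ β₀ : ℝ, ∀ β : ℝ, β₀ ≤ β → ∃ S₀ : ℕ, ∀ S : ℕ, S₀ ≤ S →
      let μ := wilsonMeasure (d := 4) (L := 2 * S + 1) r.ρ β
      let fro : Matrix (Fin r.N) (Fin r.N) ℂ → ℝ := fun M => ∑ a, ∑ b, ‖M a b‖ ^ 2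
      let coul : GaugeConfig 4 (2 * S + 1) G → (Site 4 (2 * S + 1) → G) → ℝ := fun U h =>
        -∑ e : Edge 4 (2 * S + 1),
          (if e.1 0 = 0 ∧ e.2 ≠ 0 then (r.ρ (gaugeTransform h U e)).trace.re else 0)
      let cov : GaugeConfig 4 (2 * S + 1) G → (Site 4 (2 * S + 1) → G) →
          (Fin 3 → ZMod (2 * S + 1)) → ℝ := fun U h p =>
        (∑ j : Fin 3, fro (∑ y : Fin 3 → ZMod (2 * S + 1),
          Complex.exp (-(2 * Real.pi * Complex.I *
            (∑ i : Fin 3, ((p i).val : ℂ) * ((y i).val : ℂ)) / (2 * S + 1 : ℂ))) •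
          ((1 / 2 : ℂ) • (r.ρ (gaugeTransform h U (Fin.cons (0 : ZMod (2 * S + 1)) y, j.succ)) -
            (r.ρ (gaugeTransform h U (Fin.cons (0 : ZMod (2 * S + 1)) y, j.succ)))ᴴ)))) /
          ((2 * S + 1 : ℝ) ^ 3)
      let Dmax : ℝ := ⨆ p : Fin 3 → ZMod (2 * S + 1),
        ∫ U, (⨆ h : {h : Site 4 (2 * S + 1) → G // ∀ h', coul U h ≤ coul U h'}, cov U h.1 p) ∂μ
      let slope : (GaugeConfig 4 (2 * S + 1) G → ℝ) → GaugeConfig 4 (2 * S + 1) G →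
          Edge 4 (2 * S + 1) → ℝ := fun f U e =>
        Filter.limsup (fun g : G => |f (Function.update U e g) - f U| /
          Real.sqrt (fro (r.ρ g - r.ρ (U e)))) (𝓝[≠] (U e))
      let dir : (GaugeConfig 4 (2 * S + 1) G → ℝ) → ℝ := fun f =>
        ∑ e : Edge 4 (2 * S + 1), (if e.1 0 = 0 ∧ e.2 ≠ 0 then ∫ U, (slope f U e) ^ 2 ∂μ else 0)
      ∀ f : GaugeConfig 4 (2 * S + 1) G → ℝ, IsGaugeInvariant f →
        (∀ U V : GaugeConfig 4 (2 * S + 1) G,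
          (∀ e : Edge 4 (2 * S + 1), e.1 0 = 0 → e.2 ≠ 0 → U e = V e) → f U = f V) →
        ∫ U, (f U - ∫ V, f V ∂μ) ^ 2 ∂μ ≤ C * Dmax * dir f) := by
  intro hBL
  have hSU := isCompactSimpleLieGroup_specialUnitaryGroup h (le_refl 2)
  obtain ⟨r⟩ := hSU.2
  exact brascampLiebVacuum_false_without_lipschitz hSU r (hBL _ hSU r)

end Lipschitz



section Discrete

/-- On `ℝ` every `limsup` along `⊥` is the junk value `sInf univ = 0`. [folklore] -/
theorem limsup_bot_real {α : Type*} (u : α → ℝ) : Filter.limsup u (⊥ : Filter α) = 0 := by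
  rw [Filter.limsup_eq]
  simp only [Filter.eventually_bot, Set.setOf_true]
  exact Real.sInf_of_not_bddBelow not_bddBelow_univ

/-- In a discrete space punctured neighbourhood filters are trivial. [folklore] -/
theorem nhdsWithin_compl_singleton_eq_bot_of_discrete {X : Type*} [TopologicalSpace X]
    [DiscreteTopology X] (x : X) : 𝓝[≠] x = ⊥ := by
  rw [← Filter.empty_mem_iff_bot, mem_nhdsWithin]
  exact ⟨{x}, isOpen_discrete _, rfl, fun y hy => hy.2 hy.1⟩

variable {G : Type*} [Group G] [TopologicalSpace G] [IsTopologicalGroup G] [CompactSpace G]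
  [MeasurableSpace G] [BorelSpace G]

/-- **For a discrete gauge group the crux's inequality fails on every torus `S ≥ 1`**, with a test
function satisfying ALL of (i)–(iii): the time-zero plaquette trace `Re tr ρ(U_p)` has every
`slope` equal to `limsup _ ⊥ = 0`, so `dir f = 0`, and positive variance as soon as `ρ` is not
identically `1` (e.g. `G` non-trivial, `ρ` faithful). [folklore] -/
theorem brascampLiebVacuum_false_of_discrete_at [DiscreteTopology G] (r : LatticeRep G)
    (hr : ∃ a : G, r.ρ a ≠ 1) (C β : ℝ) {S : ℕ} (hS : 1 ≤ S) :
    let μ := wilsonMeasure (d := 4) (L := 2 * S + 1) r.ρ β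
    let fro : Matrix (Fin r.N) (Fin r.N) ℂ → ℝ := fun M => ∑ a, ∑ b, ‖M a b‖ ^ 2
    let coul : GaugeConfig 4 (2 * S + 1) G → (Site 4 (2 * S + 1) → G) → ℝ := fun U h =>
      -∑ e : Edge 4 (2 * S + 1),
        (if e.1 0 = 0 ∧ e.2 ≠ 0 then (r.ρ (gaugeTransform h U e)).trace.re else 0)
    let cov : GaugeConfig 4 (2 * S + 1) G → (Site 4 (2 * S + 1) → G) →
        (Fin 3 → ZMod (2 * S + 1)) → ℝ := fun U h p =>
      (∑ j : Fin 3, fro (∑ y : Fin 3 → ZMod (2 * S + 1),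
        Complex.exp (-(2 * Real.pi * Complex.I *
          (∑ i : Fin 3, ((p i).val : ℂ) * ((y i).val : ℂ)) / (2 * S + 1 : ℂ))) •
        ((1 / 2 : ℂ) • (r.ρ (gaugeTransform h U (Fin.cons (0 : ZMod (2 * S + 1)) y, j.succ)) -
          (r.ρ (gaugeTransform h U (Fin.cons (0 : ZMod (2 * S + 1)) y, j.succ)))ᴴ)))) /
        ((2 * S + 1 : ℝ) ^ 3)
    let Dmax : ℝ := ⨆ p : Fin 3 → ZMod (2 * S + 1),
      ∫ U, (⨆ h : {h : Site 4 (2 * S + 1) → G // ∀ h', coul U h ≤ coul U h'}, cov U h.1 p) ∂μ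
    let slope : (GaugeConfig 4 (2 * S + 1) G → ℝ) → GaugeConfig 4 (2 * S + 1) G →
        Edge 4 (2 * S + 1) → ℝ := fun f U e =>
      Filter.limsup (fun g : G => |f (Function.update U e g) - f U| /
        Real.sqrt (fro (r.ρ g - r.ρ (U e)))) (𝓝[≠] (U e))
    let dir : (GaugeConfig 4 (2 * S + 1) G → ℝ) → ℝ := fun f =>
      ∑ e : Edge 4 (2 * S + 1), (if e.1 0 = 0 ∧ e.2 ≠ 0 then ∫ U, (slope f U e) ^ 2 ∂μ else 0)
    ∃ f : GaugeConfig 4 (2 * S + 1) G → ℝ, IsGaugeInvariant f ∧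
      (∀ U V : GaugeConfig 4 (2 * S + 1) G,
        (∀ e : Edge 4 (2 * S + 1), e.1 0 = 0 → e.2 ≠ 0 → U e = V e) → f U = f V) ∧
      (∃ K : ℝ, ∀ U V : GaugeConfig 4 (2 * S + 1) G,
        |f U - f V| ≤ K * ∑ e, Real.sqrt (fro (r.ρ (U e) - r.ρ (V e)))) ∧
      dir f = 0 ∧ C * Dmax * dir f < ∫ U, (f U - ∫ V, f V ∂μ) ^ 2 ∂μ := by
  intro μ fro coul cov Dmax slope dir
  haveI : Fact (1 < 2 * S + 1) := ⟨by omega⟩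
  -- the time-zero plaquette trace at the origin: invariance, locality, values (inlined)
  have hGI : IsGaugeInvariant (fun U : GaugeConfig 4 (2 * S + 1) G => (r.ρ (plaquetteHolonomy U 0 1 2)).trace.re) := fun h U => by
    beta_reduce
    rw [Literature.MathematicalPhysics.QuantumLattice.plaquetteHolonomy_gaugeTransform, map_mul,
      map_mul, Matrix.trace_mul_cycle, ← map_mul, inv_mul_cancel, map_one, one_mul]
  have h10 : (1 : Fin 4) ≠ 0 := by decide
  have h20 : (2 : Fin 4) ≠ 0 := by decide
  have hloc : ∀ U V : GaugeConfig 4 (2 * S + 1) G,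
      (∀ e : Edge 4 (2 * S + 1), e.1 0 = 0 → e.2 ≠ 0 → U e = V e) →
      plaquetteHolonomy U 0 1 2 = plaquetteHolonomy V 0 1 2 := fun U V h => by
    unfold plaquetteHolonomy
    rw [h (0, 1) rfl h10, h (Site.shift 0 1, 2) (by simp [Site.shift]) h20,
      h (Site.shift 0 2, 1) (by simp [Site.shift]) h10, h (0, 2) rfl h20]
  have hupd : ∀ a : G, plaquetteHolonomy
      (Function.update (1 : GaugeConfig 4 (2 * S + 1) G) ((0 : Site 4 (2 * S + 1)), 1) a) 0 1 2 = a := by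
    intro a
    have h3 : ((Site.shift (0 : Site 4 (2 * S + 1)) 2, (1 : Fin 4)) : Edge 4 (2 * S + 1)) ≠ (0, 1) := by
      intro h
      have := congrArg (fun e : Edge 4 (2 * S + 1) => e.1 2) h
      simp [Site.shift] at this
    simp [plaquetteHolonomy, Function.update_of_ne h3]
  have hcont : Continuous (fun U : GaugeConfig 4 (2 * S + 1) G => (r.ρ (plaquetteHolonomy U 0 1 2)).trace.re) :=
    Complex.continuous_re.comp (Continuous.matrix_trace (r.continuous.comp
      (Literature.MathematicalPhysics.QuantumLattice.continuous_plaquetteHolonomy 0 1 2)))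
  have hN : (0 : ℝ) ≤ r.N := Nat.cast_nonneg _
  have hu : ∀ g, ‖r.ρ g‖ ≤ r.N := fun g =>
    Literature.MathematicalPhysics.QuantumLattice.norm_le_of_mem_unitaryGroup (r.mem_unitary g)
  have huH : ∀ g, ‖(r.ρ g)ᴴ‖ ≤ r.N := fun g => by
    rw [Matrix.frobenius_norm_conjTranspose]; exact hu g
  have hlip : ∀ U V : GaugeConfig 4 (2 * S + 1) G,
      |(r.ρ (plaquetteHolonomy U 0 1 2)).trace.re - (r.ρ (plaquetteHolonomy V 0 1 2)).trace.re| ≤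
        4 * (r.N : ℝ) ^ 4 * ∑ e, Real.sqrt (fro (r.ρ (U e) - r.ρ (V e))) := by
    intro U V
    show _ ≤ 4 * (r.N : ℝ) ^ 4 * ∑ e, Real.sqrt (∑ a, ∑ b, ‖(r.ρ (U e) - r.ρ (V e)) a b‖ ^ 2)
    simp_rw [sqrt_sum_sq_eq_norm]
    unfold plaquetteHolonomy
    simp only [map_mul, map_inv_eq_conjTranspose r.ρ r.mem_unitary]
    rw [← Complex.sub_re, ← Matrix.trace_sub]
    refine (UnitaryCayley.abs_re_trace_le _).trans ?_
    have h4 := norm_mul₄_sub_mul₄_le (A := r.ρ (U (0, 1))) (A' := r.ρ (V (0, 1)))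
      (B := r.ρ (U (Site.shift 0 1, 2))) (B' := r.ρ (V (Site.shift 0 1, 2)))
      (C := (r.ρ (U (Site.shift 0 2, 1)))ᴴ) (C' := (r.ρ (V (Site.shift 0 2, 1)))ᴴ)
      (D := (r.ρ (U (0, 2)))ᴴ) (D' := (r.ρ (V (0, 2)))ᴴ)
      hN (hu _) (huH _) (huH _) (hu _) (hu _) (huH _)
    rw [← Matrix.conjTranspose_sub, ← Matrix.conjTranspose_sub, Matrix.frobenius_norm_conjTranspose,
      Matrix.frobenius_norm_conjTranspose] at h4
    have hs : ∀ e₀ : Edge 4 (2 * S + 1),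
        ‖r.ρ (U e₀) - r.ρ (V e₀)‖ ≤ ∑ e, ‖r.ρ (U e) - r.ρ (V e)‖ := fun e₀ =>
      Finset.single_le_sum (f := fun e => ‖r.ρ (U e) - r.ρ (V e)‖) (fun _ _ => norm_nonneg _)
        (Finset.mem_univ e₀)
    have hsum := add_le_add (add_le_add (add_le_add (hs (0, 1)) (hs (Site.shift 0 1, 2)))
      (hs (Site.shift 0 2, 1))) (hs (0, 2))
    calc (r.N : ℝ) * ‖_‖ ≤ r.N * ((r.N : ℝ) ^ 3 * (4 * ∑ e, ‖r.ρ (U e) - r.ρ (V e)‖)) := by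
          refine mul_le_mul_of_nonneg_left (h4.trans ?_) hN
          refine mul_le_mul_of_nonneg_left ?_ (by positivity)
          linarith
      _ = 4 * (r.N : ℝ) ^ 4 * ∑ e, ‖r.ρ (U e) - r.ρ (V e)‖ := by ring
  refine ⟨(fun U : GaugeConfig 4 (2 * S + 1) G => (r.ρ (plaquetteHolonomy U 0 1 2)).trace.re), hGI,
    fun U V hUV => by beta_reduce; rw [hloc U V hUV], ⟨4 * (r.N : ℝ) ^ 4, hlip⟩, ?_⟩
  have hdir : dir (fun U : GaugeConfig 4 (2 * S + 1) G => (r.ρ (plaquetteHolonomy U 0 1 2)).trace.re) = 0 := by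
    show (∑ e : Edge 4 (2 * S + 1), (if e.1 0 = 0 ∧ e.2 ≠ 0 then
      ∫ U, (slope (fun U : GaugeConfig 4 (2 * S + 1) G => (r.ρ (plaquetteHolonomy U 0 1 2)).trace.re) U e) ^ 2 ∂μ else 0)) = 0
    refine Finset.sum_eq_zero fun e _ => ?_
    split_ifs with he
    · have : ∀ U, slope (fun U : GaugeConfig 4 (2 * S + 1) G => (r.ρ (plaquetteHolonomy U 0 1 2)).trace.re) U e = 0 := fun U => by
        show Filter.limsup _ _ = 0
        rw [nhdsWithin_compl_singleton_eq_bot_of_discrete]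
        exact limsup_bot_real _
      simp [this]
    · rfl
  refine ⟨hdir, ?_⟩
  rw [hdir, mul_zero]
  haveI : SecondCountableTopology G :=
    (r.continuous.isClosedEmbedding r.injective).isEmbedding.secondCountableTopology
  haveI := isOpenPosMeasure_wilsonMeasure (d := 4) (L := 2 * S + 1) r.ρ r.continuous β
  haveI := isProbabilityMeasure_wilsonMeasure (d := 4) (L := 2 * S + 1) r.ρ r.continuous β
  obtain ⟨a, ha⟩ := hr
  have hlt := re_trace_lt_of_ne_one (r.mem_unitary a) ha
  have hne : (fun U : GaugeConfig 4 (2 * S + 1) G => (r.ρ (plaquetteHolonomy U 0 1 2)).trace.re) 1 ≠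
      (fun U : GaugeConfig 4 (2 * S + 1) G => (r.ρ (plaquetteHolonomy U 0 1 2)).trace.re)
        (Function.update (1 : GaugeConfig 4 (2 * S + 1) G) ((0 : Site 4 (2 * S + 1)), 1) a) := by
    beta_reduce
    rw [Literature.MathematicalPhysics.QuantumLattice.plaquetteHolonomy_one, hupd a, map_one,
      Matrix.trace_one, Fintype.card_fin, Complex.natCast_re]
    exact hlt.ne'
  exact integral_sq_sub_pos μ hcont hne _

end Discrete

section Finite

/-- The permutation matrices of `S₃` on `ℂ³` are unitary. [folklore] -/
theorem permMatrix_mem_unitaryGroup (σ : Equiv.Perm (Fin 3)) :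
    Equiv.Perm.permMatrix ℂ σ ∈ Matrix.unitaryGroup (Fin 3) ℂ := by
  rw [Matrix.mem_unitaryGroup_iff', Matrix.star_eq_conjTranspose]
  have hH : (Equiv.Perm.permMatrix ℂ σ)ᴴ = (Equiv.Perm.permMatrix ℂ σ)ᵀ := by
    ext i j
    simp [Matrix.conjTranspose_apply, Equiv.Perm.permMatrix, PEquiv.toMatrix_apply, apply_ite]
  rw [hH, Matrix.transpose_permMatrix, ← Matrix.permMatrix_mul, mul_inv_cancel,
    Matrix.permMatrix_one]

/-- **The crux's shape is false for finite non-abelian gauge groups (unconditionally).**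
`ConvexGribovBody.BrascampLiebVacuum` with the hypothesis `IsCompactSimpleLieGroup G` replaced by
"`G` finite and non-abelian" (every other symbol verbatim) fails: take `G = S₃` with the discrete
topology (compact, Borel = `⊤`), the faithful unitary permutation representation `σ ↦ P_{σ⁻¹}` on
`ℂ³`, and apply `brascampLiebVacuum_false_of_discrete_at` on the torus `S = max S₀ 1`. Hence the
connectedness clause of `IsSimpleCompactGroup` is used essentially by any proof of the crux. [folklore] -/
theorem not_brascampLiebVacuum_for_finite_gauge_groups :
    ¬ (∀ (G : Type) [Group G] [TopologicalSpace G] [IsTopologicalGroup G] [CompactSpace G]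
      [MeasurableSpace G] [BorelSpace G], Finite G → (∃ a b : G, a * b ≠ b * a) →
      ∀ r : LatticeRep G,
      ∃ C : ℝ, 0 < C ∧ ∃ β₀ : ℝ, ∀ β : ℝ, β₀ ≤ β → ∃ S₀ : ℕ, ∀ S : ℕ, S₀ ≤ S →
      let μ := wilsonMeasure (d := 4) (L := 2 * S + 1) r.ρ β
      let fro : Matrix (Fin r.N) (Fin r.N) ℂ → ℝ := fun M => ∑ a, ∑ b, ‖M a b‖ ^ 2
      let coul : GaugeConfig 4 (2 * S + 1) G → (Site 4 (2 * S + 1) → G) → ℝ := fun U h =>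
        -∑ e : Edge 4 (2 * S + 1),
          (if e.1 0 = 0 ∧ e.2 ≠ 0 then (r.ρ (gaugeTransform h U e)).trace.re else 0)
      let cov : GaugeConfig 4 (2 * S + 1) G → (Site 4 (2 * S + 1) → G) →
          (Fin 3 → ZMod (2 * S + 1)) → ℝ := fun U h p =>
        (∑ j : Fin 3, fro (∑ y : Fin 3 → ZMod (2 * S + 1),
          Complex.exp (-(2 * Real.pi * Complex.I *
            (∑ i : Fin 3, ((p i).val : ℂ) * ((y i).val : ℂ)) / (2 * S + 1 : ℂ))) •
          ((1 / 2 : ℂ) • (r.ρ (gaugeTransform h U (Fin.cons (0 : ZMod (2 * S + 1)) y, j.succ)) -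
            (r.ρ (gaugeTransform h U (Fin.cons (0 : ZMod (2 * S + 1)) y, j.succ)))ᴴ)))) /
          ((2 * S + 1 : ℝ) ^ 3)
      let Dmax : ℝ := ⨆ p : Fin 3 → ZMod (2 * S + 1),
        ∫ U, (⨆ h : {h : Site 4 (2 * S + 1) → G // ∀ h', coul U h ≤ coul U h'}, cov U h.1 p) ∂μ
      let slope : (GaugeConfig 4 (2 * S + 1) G → ℝ) → GaugeConfig 4 (2 * S + 1) G →
          Edge 4 (2 * S + 1) → ℝ := fun f U e =>
        Filter.limsup (fun g : G => |f (Function.update U e g) - f U| /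
          Real.sqrt (fro (r.ρ g - r.ρ (U e)))) (𝓝[≠] (U e))
      let dir : (GaugeConfig 4 (2 * S + 1) G → ℝ) → ℝ := fun f =>
        ∑ e : Edge 4 (2 * S + 1), (if e.1 0 = 0 ∧ e.2 ≠ 0 then ∫ U, (slope f U e) ^ 2 ∂μ else 0)
      ∀ f : GaugeConfig 4 (2 * S + 1) G → ℝ, IsGaugeInvariant f →
        (∀ U V : GaugeConfig 4 (2 * S + 1) G,
          (∀ e : Edge 4 (2 * S + 1), e.1 0 = 0 → e.2 ≠ 0 → U e = V e) → f U = f V) →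
        (∃ K : ℝ, ∀ U V : GaugeConfig 4 (2 * S + 1) G,
          |f U - f V| ≤ K * ∑ e, Real.sqrt (fro (r.ρ (U e) - r.ρ (V e)))) →
        ∫ U, (f U - ∫ V, f V ∂μ) ^ 2 ∂μ ≤ C * Dmax * dir f) := by
  intro hBL
  letI : TopologicalSpace (Equiv.Perm (Fin 3)) := ⊥
  haveI : DiscreteTopology (Equiv.Perm (Fin 3)) := ⟨rfl⟩
  haveI : IsTopologicalGroup (Equiv.Perm (Fin 3)) :=
    { continuous_mul := continuous_of_discreteTopology
      continuous_inv := continuous_of_discreteTopology }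
  letI : MeasurableSpace (Equiv.Perm (Fin 3)) := ⊤
  haveI : BorelSpace (Equiv.Perm (Fin 3)) := ⟨(borel_eq_top_of_discrete).symm⟩
  -- the permutation representation `σ ↦ P_{σ⁻¹}`
  let ρ : Equiv.Perm (Fin 3) →* Matrix (Fin 3) (Fin 3) ℂ :=
    { toFun := fun σ => Equiv.Perm.permMatrix ℂ σ⁻¹
      map_one' := by simp [Matrix.permMatrix_one]
      map_mul' := fun σ τ => by
        simp only [mul_inv_rev, Matrix.permMatrix_mul] }
  have hρ : ∀ σ, ρ σ = Equiv.Perm.permMatrix ℂ σ⁻¹ := fun σ => rfl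
  have hinj : Function.Injective ρ := by
    intro σ τ h
    rw [hρ, hρ] at h
    have h' : (Equiv.toPEquiv σ⁻¹) = Equiv.toPEquiv τ⁻¹ := PEquiv.toMatrix_injective h
    have : σ⁻¹ = τ⁻¹ := Equiv.ext fun x => by
      have := congrArg (fun f : Fin 3 ≃. Fin 3 => f x) h'
      simpa using this
    exact inv_injective this
  let r : LatticeRep (Equiv.Perm (Fin 3)) :=
    ⟨3, ρ, continuous_of_discreteTopology, hinj, fun σ => permMatrix_mem_unitaryGroup σ⁻¹⟩
  have hab : ∃ a b : Equiv.Perm (Fin 3), a * b ≠ b * a :=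
    ⟨Equiv.swap 0 1, Equiv.swap 1 2, by decide⟩
  obtain ⟨C, -, β₀, h⟩ := hBL (Equiv.Perm (Fin 3)) inferInstance hab r
  obtain ⟨S₀, hS₀⟩ := h β₀ le_rfl
  have h1 := hS₀ (max S₀ 1) (le_max_left _ _)
  have hr : ∃ a : Equiv.Perm (Fin 3), r.ρ a ≠ 1 := by
    refine ⟨Equiv.swap 0 1, fun h => ?_⟩
    have : Equiv.swap (0 : Fin 3) 1 = 1 := r.injective (by rw [h, map_one])
    exact absurd this (by decide)
  obtain ⟨f, hf₁, hf₂, hf₃, -, hlt⟩ := brascampLiebVacuum_false_of_discrete_at r hr C β₀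
    (S := max S₀ 1) (le_max_right _ _)
  exact absurd (h1 f hf₁ hf₂ hf₃) (not_le.2 hlt)

end Finite



section Volume

variable {G : Type*} [Group G] [TopologicalSpace G] [IsTopologicalGroup G] [CompactSpace G]
  [MeasurableSpace G] [BorelSpace G]

omit [IsTopologicalGroup G] [CompactSpace G] [MeasurableSpace G] [BorelSpace G] in
/-- The anti-Hermitian part of a represented group element has Frobenius norm `≤ √N`. [folklore] -/
theorem norm_antiHermitianPart_le (r : LatticeRep G) (g : G) :
    ‖(1 / 2 : ℂ) • (r.ρ g - (r.ρ g)ᴴ)‖ ≤ Real.sqrt r.N := by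
  have hu : ‖r.ρ g‖ = Real.sqrt r.N := by
    have h := WilsonWeakCoupling.norm_coe_sq (⟨r.ρ g, r.mem_unitary g⟩ : UnitaryCayley.𝔾 r.N)
    simp only at h
    rw [← h, Real.sqrt_sq (norm_nonneg _)]
  calc ‖(1 / 2 : ℂ) • (r.ρ g - (r.ρ g)ᴴ)‖ = (1 / 2) * ‖r.ρ g - (r.ρ g)ᴴ‖ := by
        rw [norm_smul]; norm_num
    _ ≤ (1 / 2) * (‖r.ρ g‖ + ‖(r.ρ g)ᴴ‖) := by gcongr; exact norm_sub_le _ _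
    _ = Real.sqrt r.N := by rw [Matrix.frobenius_norm_conjTranspose, hu]; ring

/-- The lattice Fourier phases have modulus one. [folklore] -/
theorem norm_exp_phase (S : ℕ) (p y : Fin 3 → ZMod (2 * S + 1)) :
    ‖Complex.exp (-(2 * Real.pi * Complex.I *
        (∑ i : Fin 3, ((p i).val : ℂ) * ((y i).val : ℂ)) / (2 * S + 1 : ℂ)))‖ = 1 := by
  have : -(2 * Real.pi * Complex.I * (∑ i : Fin 3, ((p i).val : ℂ) * ((y i).val : ℂ)) /
      (2 * S + 1 : ℂ)) =
      ((-(2 * Real.pi * (∑ i : Fin 3, ((p i).val : ℝ) * ((y i).val : ℝ)) / (2 * S + 1)) : ℝ) : ℂ) *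
        Complex.I := by
    push_cast
    ring
  rw [this, Complex.norm_exp_ofReal_mul_I]


/-- Frobenius bound for a finite sum of unimodular multiples of norm-bounded matrices, in the
crux's `fro` form. [folklore] -/
theorem sum_norm_sq_sum_smul_le {ι : Type*} [Fintype ι] {N : ℕ} (c : ι → ℂ)
    (M : ι → Matrix (Fin N) (Fin N) ℂ) {B : ℝ} (hc : ∀ i, ‖c i‖ = 1) (hM : ∀ i, ‖M i‖ ≤ B) :
    ∑ a, ∑ b, ‖(∑ i, c i • M i) a b‖ ^ 2 ≤ (Fintype.card ι * B) ^ 2 := by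
  rw [← UnitaryCayley.frobenius_norm_sq]
  have h : ‖∑ i, c i • M i‖ ≤ Fintype.card ι * B := by
    refine (norm_sum_le _ _).trans ?_
    calc ∑ i, ‖c i • M i‖ ≤ ∑ _i, B := Finset.sum_le_sum fun i _ => by
            rw [norm_smul, hc, one_mul]; exact hM i
      _ = Fintype.card ι * B := by rw [Finset.sum_const, Finset.card_univ, nsmul_eq_mul]
  exact pow_le_pow_left₀ (norm_nonneg _) h 2

/-- **The trivial volume bound `Dmax ≤ 3 N (2S+1)³`** on the crux's covariance scale (any compact
`G`, any `r`, `β`, `S`; `coul`, `cov`, `Dmax` verbatim from the crux). [folklore] -/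
theorem dmax_le_volume (r : LatticeRep G) (β : ℝ) (S : ℕ) :
    let μ := wilsonMeasure (d := 4) (L := 2 * S + 1) r.ρ β
    let fro : Matrix (Fin r.N) (Fin r.N) ℂ → ℝ := fun M => ∑ a, ∑ b, ‖M a b‖ ^ 2
    let coul : GaugeConfig 4 (2 * S + 1) G → (Site 4 (2 * S + 1) → G) → ℝ := fun U h =>
      -∑ e : Edge 4 (2 * S + 1),
        (if e.1 0 = 0 ∧ e.2 ≠ 0 then (r.ρ (gaugeTransform h U e)).trace.re else 0)
    let cov : GaugeConfig 4 (2 * S + 1) G → (Site 4 (2 * S + 1) → G) →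
        (Fin 3 → ZMod (2 * S + 1)) → ℝ := fun U h p =>
      (∑ j : Fin 3, fro (∑ y : Fin 3 → ZMod (2 * S + 1),
        Complex.exp (-(2 * Real.pi * Complex.I *
          (∑ i : Fin 3, ((p i).val : ℂ) * ((y i).val : ℂ)) / (2 * S + 1 : ℂ))) •
        ((1 / 2 : ℂ) • (r.ρ (gaugeTransform h U (Fin.cons (0 : ZMod (2 * S + 1)) y, j.succ)) -
          (r.ρ (gaugeTransform h U (Fin.cons (0 : ZMod (2 * S + 1)) y, j.succ)))ᴴ)))) /
        ((2 * S + 1 : ℝ) ^ 3)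
    let Dmax : ℝ := ⨆ p : Fin 3 → ZMod (2 * S + 1),
      ∫ U, (⨆ h : {h : Site 4 (2 * S + 1) → G // ∀ h', coul U h ≤ coul U h'}, cov U h.1 p) ∂μ
    Dmax ≤ 3 * (r.N : ℝ) * (2 * S + 1 : ℝ) ^ 3 := by
  intro μ fro coul cov Dmax
  have hL : (0 : ℝ) < (2 * S + 1 : ℝ) := by positivity
  have hcard : (Fintype.card (Fin 3 → ZMod (2 * S + 1)) : ℝ) = (2 * S + 1 : ℝ) ^ 3 := by
    rw [Fintype.card_fun, ZMod.card, Fintype.card_fin]; push_cast; ring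
  -- pointwise bound on `cov`
  have hsq : ((2 * S + 1 : ℝ) ^ 3 * Real.sqrt r.N) ^ 2 = (r.N : ℝ) * ((2 * S + 1 : ℝ) ^ 3) ^ 2 := by
    rw [mul_pow, Real.sq_sqrt (Nat.cast_nonneg _)]; ring
  have hcov : ∀ U h p, cov U h p ≤ 3 * (r.N : ℝ) * (2 * S + 1 : ℝ) ^ 3 := by
    intro U h p
    have hj : ∀ j : Fin 3, fro (∑ y : Fin 3 → ZMod (2 * S + 1),
        Complex.exp (-(2 * Real.pi * Complex.I *
          (∑ i : Fin 3, ((p i).val : ℂ) * ((y i).val : ℂ)) / (2 * S + 1 : ℂ))) •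
        ((1 / 2 : ℂ) • (r.ρ (gaugeTransform h U (Fin.cons (0 : ZMod (2 * S + 1)) y, j.succ)) -
          (r.ρ (gaugeTransform h U (Fin.cons (0 : ZMod (2 * S + 1)) y, j.succ)))ᴴ))) ≤
        (r.N : ℝ) * ((2 * S + 1 : ℝ) ^ 3) ^ 2 := fun j => by
      have h1 := sum_norm_sq_sum_smul_le (ι := Fin 3 → ZMod (2 * S + 1))
        (fun y => Complex.exp (-(2 * Real.pi * Complex.I *
          (∑ i : Fin 3, ((p i).val : ℂ) * ((y i).val : ℂ)) / (2 * S + 1 : ℂ))))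
        (fun y => (1 / 2 : ℂ) • (r.ρ (gaugeTransform h U (Fin.cons (0 : ZMod (2 * S + 1)) y, j.succ)) -
          (r.ρ (gaugeTransform h U (Fin.cons (0 : ZMod (2 * S + 1)) y, j.succ)))ᴴ))
        (fun y => norm_exp_phase S p y) (fun y => norm_antiHermitianPart_le r _)
      rw [hcard, hsq] at h1
      exact h1
    have hsum : (∑ j : Fin 3, fro (∑ y : Fin 3 → ZMod (2 * S + 1),
        Complex.exp (-(2 * Real.pi * Complex.I *
          (∑ i : Fin 3, ((p i).val : ℂ) * ((y i).val : ℂ)) / (2 * S + 1 : ℂ))) •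
        ((1 / 2 : ℂ) • (r.ρ (gaugeTransform h U (Fin.cons (0 : ZMod (2 * S + 1)) y, j.succ)) -
          (r.ρ (gaugeTransform h U (Fin.cons (0 : ZMod (2 * S + 1)) y, j.succ)))ᴴ)))) ≤
        3 * (r.N : ℝ) * (2 * S + 1 : ℝ) ^ 3 * (2 * S + 1 : ℝ) ^ 3 :=
      calc _ ≤ ∑ _j : Fin 3, (r.N : ℝ) * ((2 * S + 1 : ℝ) ^ 3) ^ 2 :=
            Finset.sum_le_sum fun j _ => hj j
        _ = 3 * (r.N : ℝ) * (2 * S + 1 : ℝ) ^ 3 * (2 * S + 1 : ℝ) ^ 3 := by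
            rw [Finset.sum_const, Finset.card_univ, Fintype.card_fin, nsmul_eq_mul]; push_cast; ring
    exact (div_le_iff₀ (by positivity)).2 hsum
  have hcov0 : ∀ U h p, 0 ≤ cov U h p := fun U h p => by
    refine div_nonneg (Finset.sum_nonneg fun j _ => ?_) (by positivity)
    exact Finset.sum_nonneg fun a _ => Finset.sum_nonneg fun b _ => by positivity
  have hB : 0 ≤ 3 * (r.N : ℝ) * (2 * S + 1 : ℝ) ^ 3 := by positivity
  -- `⨆ h`, `∫`, `⨆ p`
  refine Real.iSup_le (fun p => ?_) hB
  have hsup : ∀ U, (⨆ h : {h : Site 4 (2 * S + 1) → G // ∀ h', coul U h ≤ coul U h'}, cov U h.1 p) ≤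
      3 * (r.N : ℝ) * (2 * S + 1 : ℝ) ^ 3 := fun U => Real.iSup_le (fun h => hcov U h.1 p) hB
  have hsup0 : ∀ U, 0 ≤ (⨆ h : {h : Site 4 (2 * S + 1) → G // ∀ h', coul U h ≤ coul U h'}, cov U h.1 p) :=
    fun U => Real.iSup_nonneg fun h => hcov0 U h.1 p
  haveI := isProbabilityMeasure_wilsonMeasure (d := 4) (L := 2 * S + 1) r.ρ r.continuous β
  calc ∫ U, (⨆ h : {h : Site 4 (2 * S + 1) → G // ∀ h', coul U h ≤ coul U h'}, cov U h.1 p) ∂μ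
      ≤ ∫ _U, 3 * (r.N : ℝ) * (2 * S + 1 : ℝ) ^ 3 ∂μ :=
        integral_mono_of_nonneg (Eventually.of_forall hsup0) (integrable_const _)
          (Eventually.of_forall hsup)
    _ = 3 * (r.N : ℝ) * (2 * S + 1 : ℝ) ^ 3 := by
        rw [integral_const, smul_eq_mul]
        simp

end Volume


/-! ### F3 made precise: how a test-function lower bound turns into a covariance lower bound -/

section Reduction

variable {G : Type} [Group G] [TopologicalSpace G] [IsTopologicalGroup G] [CompactSpace G]
  [MeasurableSpace G] [BorelSpace G]

/-- **The crux converts every admissible Poincaré-ratio lower bound into a lower bound on the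
Coulomb covariance scale** (bookkeeping form of F3 / `TrapObstruction-ideator1.md` §3): if the
crux's inequality holds on the torus `S` at coupling `β` with constant `C`, then every admissible
`f` with `dir f > 0` and `Var_μ f ≥ ϱ · dir f` forces `ϱ ≤ C · Dmax(β, S)`. With the trap family
(`ϱ = e^{(2−12π²/N−o(1))β}`, `SU(N ≥ 60)` fundamental, local `t = 0` function — NOT formalised) the
β-uniform `C` of the crux forces `Dmax(β,S) ≥ C⁻¹e^{(2−12π²/N)β}` on all large tori, against the
asymptotic-scaling expectation `Dmax ≍ ξ/β ≍ e^{12π²β/(11N)}` once `N ≥ 16`. A REFUTATION along this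
line needs, in addition to the trap lower bound, an `S`-uniform upper bound
`Dmax(β,S) ≤ A e^{cβ}`, `c < 2 − 12π²/N` — a quantitative `CovarianceBound`, unavailable. [folklore] -/
theorem ratio_le_of_inner (r : LatticeRep G) (C β ϱ : ℝ) (S : ℕ) :
    let μ := wilsonMeasure (d := 4) (L := 2 * S + 1) r.ρ β
    let fro : Matrix (Fin r.N) (Fin r.N) ℂ → ℝ := fun M => ∑ a, ∑ b, ‖M a b‖ ^ 2
    let coul : GaugeConfig 4 (2 * S + 1) G → (Site 4 (2 * S + 1) → G) → ℝ := fun U h =>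
      -∑ e : Edge 4 (2 * S + 1),
        (if e.1 0 = 0 ∧ e.2 ≠ 0 then (r.ρ (gaugeTransform h U e)).trace.re else 0)
    let cov : GaugeConfig 4 (2 * S + 1) G → (Site 4 (2 * S + 1) → G) →
        (Fin 3 → ZMod (2 * S + 1)) → ℝ := fun U h p =>
      (∑ j : Fin 3, fro (∑ y : Fin 3 → ZMod (2 * S + 1),
        Complex.exp (-(2 * Real.pi * Complex.I *
          (∑ i : Fin 3, ((p i).val : ℂ) * ((y i).val : ℂ)) / (2 * S + 1 : ℂ))) •
        ((1 / 2 : ℂ) • (r.ρ (gaugeTransform h U (Fin.cons (0 : ZMod (2 * S + 1)) y, j.succ)) -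
          (r.ρ (gaugeTransform h U (Fin.cons (0 : ZMod (2 * S + 1)) y, j.succ)))ᴴ)))) /
        ((2 * S + 1 : ℝ) ^ 3)
    let Dmax : ℝ := ⨆ p : Fin 3 → ZMod (2 * S + 1),
      ∫ U, (⨆ h : {h : Site 4 (2 * S + 1) → G // ∀ h', coul U h ≤ coul U h'}, cov U h.1 p) ∂μ
    let slope : (GaugeConfig 4 (2 * S + 1) G → ℝ) → GaugeConfig 4 (2 * S + 1) G →
        Edge 4 (2 * S + 1) → ℝ := fun f U e =>
      Filter.limsup (fun g : G => |f (Function.update U e g) - f U| /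
        Real.sqrt (fro (r.ρ g - r.ρ (U e)))) (𝓝[≠] (U e))
    let dir : (GaugeConfig 4 (2 * S + 1) G → ℝ) → ℝ := fun f =>
      ∑ e : Edge 4 (2 * S + 1), (if e.1 0 = 0 ∧ e.2 ≠ 0 then ∫ U, (slope f U e) ^ 2 ∂μ else 0)
    (∀ f : GaugeConfig 4 (2 * S + 1) G → ℝ, IsGaugeInvariant f →
      (∀ U V : GaugeConfig 4 (2 * S + 1) G,
        (∀ e : Edge 4 (2 * S + 1), e.1 0 = 0 → e.2 ≠ 0 → U e = V e) → f U = f V) →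
      (∃ K : ℝ, ∀ U V : GaugeConfig 4 (2 * S + 1) G,
        |f U - f V| ≤ K * ∑ e, Real.sqrt (fro (r.ρ (U e) - r.ρ (V e)))) →
      ∫ U, (f U - ∫ V, f V ∂μ) ^ 2 ∂μ ≤ C * Dmax * dir f) →
    ∀ f : GaugeConfig 4 (2 * S + 1) G → ℝ, IsGaugeInvariant f →
      (∀ U V : GaugeConfig 4 (2 * S + 1) G,
        (∀ e : Edge 4 (2 * S + 1), e.1 0 = 0 → e.2 ≠ 0 → U e = V e) → f U = f V) →
      (∃ K : ℝ, ∀ U V : GaugeConfig 4 (2 * S + 1) G,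
        |f U - f V| ≤ K * ∑ e, Real.sqrt (fro (r.ρ (U e) - r.ρ (V e)))) →
      0 < dir f → ϱ * dir f ≤ ∫ U, (f U - ∫ V, f V ∂μ) ^ 2 ∂μ → ϱ ≤ C * Dmax := by
  intro μ fro coul cov Dmax slope dir hBL f hf₁ hf₂ hf₃ hdir hϱ
  have h := (hϱ.trans (hBL f hf₁ hf₂ hf₃))
  exact le_of_mul_le_mul_right h hdir

end Reduction


/-! ### F3 repair service for the planner: `C` after `β` suffices for the route -/

section Repair

/-- **The recommended repair of the crux** (F3): `∃ C` moved AFTER `∀ β ≥ β₀` — for every compact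
simple `G` and `r` there is `β₀` such that for every `β ≥ β₀` there are `C(β) > 0` and `S₀(β)` with
the same Poincaré inequality on all tori `S ≥ S₀`. Strictly weaker than
`ConvexGribovBody.BrascampLiebVacuum` (`brascampLiebVacuumPerBeta_of`), immune to the trap
obstruction of `TrapObstruction-ideator1.md` (which only attacks β-uniformity of `C`), and it
closes the route unchanged (`closes_of_perBeta`). Offered to the planner's repair mode; not a
route item. [folklore] -/
def BrascampLiebVacuumPerBeta : Prop :=
  ∀ (G : Type) [Group G] [TopologicalSpace G] [IsTopologicalGroup G] [CompactSpace G]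
    [MeasurableSpace G] [BorelSpace G], IsCompactSimpleLieGroup G → ∀ r : LatticeRep G,
    ∃ β₀ : ℝ, ∀ β : ℝ, β₀ ≤ β → ∃ C : ℝ, 0 < C ∧ ∃ S₀ : ℕ, ∀ S : ℕ, S₀ ≤ S →
    let μ := wilsonMeasure (d := 4) (L := 2 * S + 1) r.ρ β
    let fro : Matrix (Fin r.N) (Fin r.N) ℂ → ℝ := fun M => ∑ a, ∑ b, ‖M a b‖ ^ 2
    let coul : GaugeConfig 4 (2 * S + 1) G → (Site 4 (2 * S + 1) → G) → ℝ := fun U h =>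
      -∑ e : Edge 4 (2 * S + 1),
        (if e.1 0 = 0 ∧ e.2 ≠ 0 then (r.ρ (gaugeTransform h U e)).trace.re else 0)
    let cov : GaugeConfig 4 (2 * S + 1) G → (Site 4 (2 * S + 1) → G) →
        (Fin 3 → ZMod (2 * S + 1)) → ℝ := fun U h p =>
      (∑ j : Fin 3, fro (∑ y : Fin 3 → ZMod (2 * S + 1),
        Complex.exp (-(2 * Real.pi * Complex.I *
          (∑ i : Fin 3, ((p i).val : ℂ) * ((y i).val : ℂ)) / (2 * S + 1 : ℂ))) •
        ((1 / 2 : ℂ) • (r.ρ (gaugeTransform h U (Fin.cons (0 : ZMod (2 * S + 1)) y, j.succ)) -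
          (r.ρ (gaugeTransform h U (Fin.cons (0 : ZMod (2 * S + 1)) y, j.succ)))ᴴ)))) /
        ((2 * S + 1 : ℝ) ^ 3)
    let Dmax : ℝ := ⨆ p : Fin 3 → ZMod (2 * S + 1),
      ∫ U, (⨆ h : {h : Site 4 (2 * S + 1) → G // ∀ h', coul U h ≤ coul U h'}, cov U h.1 p) ∂μ
    let slope : (GaugeConfig 4 (2 * S + 1) G → ℝ) → GaugeConfig 4 (2 * S + 1) G →
        Edge 4 (2 * S + 1) → ℝ := fun f U e =>
      Filter.limsup (fun g : G => |f (Function.update U e g) - f U| /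
        Real.sqrt (fro (r.ρ g - r.ρ (U e)))) (𝓝[≠] (U e))
    let dir : (GaugeConfig 4 (2 * S + 1) G → ℝ) → ℝ := fun f =>
      ∑ e : Edge 4 (2 * S + 1), (if e.1 0 = 0 ∧ e.2 ≠ 0 then ∫ U, (slope f U e) ^ 2 ∂μ else 0)
    ∀ f : GaugeConfig 4 (2 * S + 1) G → ℝ, IsGaugeInvariant f →
      (∀ U V : GaugeConfig 4 (2 * S + 1) G,
        (∀ e : Edge 4 (2 * S + 1), e.1 0 = 0 → e.2 ≠ 0 → U e = V e) → f U = f V) →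
      (∃ K : ℝ, ∀ U V : GaugeConfig 4 (2 * S + 1) G,
        |f U - f V| ≤ K * ∑ e, Real.sqrt (fro (r.ρ (U e) - r.ρ (V e)))) →
      ∫ U, (f U - ∫ V, f V ∂μ) ^ 2 ∂μ ≤ C * Dmax * dir f

/-- The crux implies its per-`β` repair (the converse is the content of F3 and is NOT claimed). [folklore] -/
theorem brascampLiebVacuumPerBeta_of
    (h : Summit.QuantumFields.YangMills.Theses.ConvexGribovBody.BrascampLiebVacuum) :
    BrascampLiebVacuumPerBeta := by
  intro G _ _ _ _ _ _ hG r
  obtain ⟨C, hC, β₀, hβ⟩ := h G hG r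
  exact ⟨β₀, fun β hb => ⟨C, hC, hβ β hb⟩⟩

/-- **The repaired crux closes the route unchanged**: the route's deciding theorem
`ConvexGribovBody.closes` consumes `κ = C · D(β)` one `β` at a time, so `BrascampLiebVacuumPerBeta`
can replace `BrascampLiebVacuum` in the assembly (same proof, `C` obtained after `β`). [folklore] -/
theorem closes_of_perBeta (h₁ : BrascampLiebVacuumPerBeta)
    (h₂ : Summit.QuantumFields.YangMills.Theses.ConvexGribovBody.CovarianceBound)
    (h₃ : Summit.QuantumFields.YangMills.Theses.ConvexGribovBody.PoincareToGap)
    (h₄ : Summit.QuantumFields.YangMills.Theses.ConvexGribovBody.ContinuumLegGivenGap) :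
    YangMills := by
  intro G _ _ _ _ hG
  letI : MeasurableSpace G := borel G
  haveI : BorelSpace G := ⟨rfl⟩
  refine h₄ G hG fun r => ?_
  obtain ⟨β₁, hBL⟩ := h₁ G hG r
  obtain ⟨β₂, hCB⟩ := h₂ G hG r
  refine ⟨max (max β₁ β₂) 1, fun β hβ => ?_⟩
  have hβ₁ : β₁ ≤ β := le_trans (le_trans (le_max_left _ _) (le_max_left _ _)) hβ
  have hβ₂ : β₂ ≤ β := le_trans (le_trans (le_max_right _ _) (le_max_left _ _)) hβ
  have hβ0 : 0 < β := lt_of_lt_of_le one_pos (le_trans (le_max_right _ _) hβ)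
  obtain ⟨C, hC, S₀, hS₀⟩ := hBL β hβ₁
  obtain ⟨D, hD, S₀', hS₀'⟩ := hCB β hβ₂
  refine h₃ G hG r β hβ0 (C * D) (mul_pos hC hD) (max S₀ S₀') fun S hS => ?_
  intro μ fro slope dir f hf₁ hf₂ hf₃
  have hA := hS₀ S (le_trans (le_max_left _ _) hS) f hf₁ hf₂ hf₃
  have hB := hS₀' S (le_trans (le_max_right _ _) hS)
  have hdir : 0 ≤ dir f := by
    refine Finset.sum_nonneg fun e _ => ?_
    split_ifs
    · exact integral_nonneg fun U => sq_nonneg _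
    · exact le_rfl
  refine le_trans hA ?_
  exact mul_le_mul_of_nonneg_right (mul_le_mul_of_nonneg_left (ciSup_le fun p => hB p) hC.le) hdir

end Repair

/-! ### Near-misses and open regimes (docstring record; no `sorry` theorem is kept whose
statement would be weaker than its prose)

* Trap + scaling ⇒ ¬crux (F3): both inputs missing, see `ratio_le_of_inner`.
* Finite-volume / femto-universe slow modes (torons, centre sectors of spatial Polyakov loops,
  `Luscher1983`): all absorbed by `∃ S₀(β)`; they only matter if `ξ(β) = ∞`, which nobody can use.
* Fixed-`β` volume growth of `Var/dir` (a gapless or phase-coexistence slow mode at arbitrarily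
  large `β`): would refute even with the trivial `Dmax ≤ 3N(2S+1)³`… no: that bound grows like
  `S³`, so one would need `Var/dir ≫ S³`, i.e. surface-tension metastability `e^{cS²}` at a
  first-order point — Wilson `SU(N)` has none at weak coupling; mixed-character actions
  `β·Re χ_r` (reducible `r`) have bulk transitions only at bounded `β`, dodged by `β₀`.
* High-spin / reducible `r` engineering (make a non-identity local maximum of `Re χ_r` nearly
  degenerate): the trap depth grows like `dim r · β` but the stiffness `β_eff = β·c_r` with
  `c_r ∝` Casimir grows faster, so asymptotic scaling wins; `SU(N ≥ 16)` fundamental stays the best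
  family (ideator 1), still unfalsifiable (F0).
-/


end Summit.QuantumFields.YangMills.Cruxes.BrascampLiebVacuum.Disproof

end
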